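import Literature.Analysis.FluidPDE.GaussLambdaWeightedSkewIdentity
import Literature.Analysis.FluidPDE.WeightedEnergyIdentity
import HarnessLib

/-!
# The `α`-uniform weighted energy estimate for `L + λM − αΛ`

Analysis/FluidPDE file (all results proved, no definitions, no named facts). For `λ ∈ [0,1)`,
`a = 1 − λ`, the Gaussian weight `p(x) = e^{a|x|²/4} ∝ G_λ(x)⁻¹` of Maekawa's space `X_λ`, and a
vorticity `w ∈ C²_c(ℝ²)`, put `f = (L + λM)w − αΛw` (`strainedVorticityOperator`, and `Λ` the
linearised Biot–Savart term at the Gaussian vortex). Then (main theorem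
`asymBurgers_uniform_energy_bound`)

  `∫ p |∇w|² + ∫ p |x|² w² ≤ C(λ) (∫ p w² + ∫ p f²)`

with `C(λ)` INDEPENDENT of the circulation `α ∈ ℝ` — the `Y_λ ∩ W_λ` part of Maekawa 2009,
Lemma 4.1 (4.1), in a-priori form. Proof (elementary, after Maekawa 2009, Prop. 4.1): test the
equation against `p u`, `u = w + Φψ` (`ψ = N ∗ w`); the `α`-term drops out by the weighted skew
identity `∫ p (Λw) u = 0` (`GaussLambdaWeightedSkewIdentity`), the principal part gives
`∫ p |∇w|²` up to `∫ p w²` (`WeightedEnergyIdentity`, `V_p ≤ p`), the correction `Φψ` is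
controlled by the Gaussian-weighted potential bounds (`GaussWeightedBiotSavartBounds`), and the
moment `∫ p|x|²w²` by the ground-state identity `0 ≤ ∫ p |∇w + (a/4) x w|²`.

## References

* Y. Maekawa, *Existence of asymmetric Burgers vortices and their asymptotic behavior at large
  circulations*, Math. Models Methods Appl. Sci. 19 (2009), §4, Lemma 4.1 (4.1), Prop. 4.1.
  [Maekawa2009b]
* Th. Gallay, Y. Maekawa, *Existence and stability of viscous vortices*, arXiv:1610.08384, §4.1,
  (4.5)–(4.9). [GallayMaekawa2016]
-/

noncomputable section

open Set Function Filter MeasureTheory Metric Real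
open scoped InnerProductSpace RealInnerProductSpace Topology Laplacian

namespace Literature.Analysis.FluidPDE

/-! ### The Gaussian weight `p = e^{a|x|²/4}` and its derivatives -/

/-- `p` is smooth. [folklore] -/
theorem contDiff_gaussWeightExp (a : ℝ) {n : WithTop ℕ∞} :
    ContDiff ℝ n fun x : EuclideanSpace ℝ (Fin 2) => Real.exp (a / 4 * ‖x‖ ^ 2) :=
  (contDiff_const.mul (contDiff_norm_sq ℝ)).exp

/-- `Dp(x) = (a/2) p(x) ⟪x, ·⟫`. [folklore] -/
theorem hasFDerivAt_gaussWeightExp (a : ℝ) (x : EuclideanSpace ℝ (Fin 2)) :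
    HasFDerivAt (fun y : EuclideanSpace ℝ (Fin 2) => Real.exp (a / 4 * ‖y‖ ^ 2))
      ((a / 2 * Real.exp (a / 4 * ‖x‖ ^ 2)) • innerSL ℝ x) x := by
  have hn : HasFDerivAt (fun y : EuclideanSpace ℝ (Fin 2) => ‖y‖ ^ 2) ((2 : ℝ) • innerSL ℝ x) x := by
    refine (hasStrictFDerivAt_norm_sq x).hasFDerivAt.congr_fderiv ?_
    ext v; simp [two_smul]
  refine ((hn.const_mul (a / 4)).exp).congr_fderiv ?_
  ext v
  simp only [_root_.smul_apply, innerSL_apply_apply, smul_eq_mul]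
  ring

/-- `∂ᵢp(x) = (a/2) xᵢ p(x)`. [folklore] -/
theorem fderiv_gaussWeightExp_single (a : ℝ) (x : EuclideanSpace ℝ (Fin 2)) (i : Fin 2) :
    fderiv ℝ (fun y : EuclideanSpace ℝ (Fin 2) => Real.exp (a / 4 * ‖y‖ ^ 2)) x
      (EuclideanSpace.single i 1) = a / 2 * x i * Real.exp (a / 4 * ‖x‖ ^ 2) := by
  rw [(hasFDerivAt_gaussWeightExp a x).fderiv, _root_.smul_apply, innerSL_apply_apply,
    EuclideanSpace.inner_single_right]
  simp only [conj_trivial, one_mul, smul_eq_mul]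
  ring

/-- `∂ᵢ∂ᵢp(x) = (a/2 + (a/2)² xᵢ²) p(x)`. [folklore] -/
theorem fderiv_fderiv_gaussWeightExp_single (a : ℝ) (x : EuclideanSpace ℝ (Fin 2)) (i : Fin 2) :
    fderiv ℝ (fun y : EuclideanSpace ℝ (Fin 2) => fderiv ℝ
      (fun z : EuclideanSpace ℝ (Fin 2) => Real.exp (a / 4 * ‖z‖ ^ 2)) y
        (EuclideanSpace.single i 1)) x (EuclideanSpace.single i 1) =
      (a / 2 + (a / 2) ^ 2 * x i ^ 2) * Real.exp (a / 4 * ‖x‖ ^ 2) := by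
  simp_rw [fderiv_gaussWeightExp_single]
  have hpi : HasFDerivAt (fun y : EuclideanSpace ℝ (Fin 2) => y i)
      (EuclideanSpace.proj i : EuclideanSpace ℝ (Fin 2) →L[ℝ] ℝ) x :=
    (EuclideanSpace.proj (i : Fin 2) : EuclideanSpace ℝ (Fin 2) →L[ℝ] ℝ).hasFDerivAt
  have h := ((hpi.const_mul (a / 2)).fun_mul (hasFDerivAt_gaussWeightExp a x))
  rw [h.fderiv, _root_.add_apply, _root_.smul_apply, _root_.smul_apply, _root_.smul_apply,
    innerSL_apply_apply, EuclideanSpace.inner_single_right]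
  simp
  ring

/-- **The zero-order weight of the energy identity for `ρ = p`:**
`½Δp + ½p − ¼((1+λ)x₀∂₀p + (1−λ)x₁∂₁p) = p ((a+1)/2 − (a(1−a)/4) x₀²)`, `a = 1 − λ`. [folklore] -/
theorem gaussWeightExp_energyWeight_eq (lam : ℝ) (x : EuclideanSpace ℝ (Fin 2)) :
    (1 / 2) * (fderiv ℝ (fun y => fderiv ℝ (fun z : EuclideanSpace ℝ (Fin 2) =>
        Real.exp ((1 - lam) / 4 * ‖z‖ ^ 2)) y (EuclideanSpace.single 0 1)) x
          (EuclideanSpace.single 0 1) +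
      fderiv ℝ (fun y => fderiv ℝ (fun z : EuclideanSpace ℝ (Fin 2) =>
        Real.exp ((1 - lam) / 4 * ‖z‖ ^ 2)) y (EuclideanSpace.single 1 1)) x
          (EuclideanSpace.single 1 1)) +
      (1 / 2) * Real.exp ((1 - lam) / 4 * ‖x‖ ^ 2) -
      (1 / 4) * ((1 + lam) * (x 0 * fderiv ℝ (fun z : EuclideanSpace ℝ (Fin 2) =>
        Real.exp ((1 - lam) / 4 * ‖z‖ ^ 2)) x (EuclideanSpace.single 0 1)) +
        (1 - lam) * (x 1 * fderiv ℝ (fun z : EuclideanSpace ℝ (Fin 2) =>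
        Real.exp ((1 - lam) / 4 * ‖z‖ ^ 2)) x (EuclideanSpace.single 1 1))) =
      Real.exp ((1 - lam) / 4 * ‖x‖ ^ 2) *
        ((2 - lam) / 2 - (1 - lam) * lam / 4 * x 0 ^ 2) := by
  rw [fderiv_fderiv_gaussWeightExp_single, fderiv_fderiv_gaussWeightExp_single,
    fderiv_gaussWeightExp_single, fderiv_gaussWeightExp_single]
  ring

/-- … and it is `≤ p` for `λ ∈ [0, 1]`. [folklore] -/
theorem gaussWeightExp_energyWeight_le {lam : ℝ} (h0 : 0 ≤ lam) (h1 : lam ≤ 1)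
    (x : EuclideanSpace ℝ (Fin 2)) :
    Real.exp ((1 - lam) / 4 * ‖x‖ ^ 2) * ((2 - lam) / 2 - (1 - lam) * lam / 4 * x 0 ^ 2) ≤
      Real.exp ((1 - lam) / 4 * ‖x‖ ^ 2) := by
  have he := Real.exp_pos ((1 - lam) / 4 * ‖x‖ ^ 2)
  have : (2 - lam) / 2 - (1 - lam) * lam / 4 * x 0 ^ 2 ≤ 1 := by
    have : 0 ≤ (1 - lam) * lam / 4 * x 0 ^ 2 := by
      have := sq_nonneg (x 0); have : 0 ≤ (1 - lam) * lam := by nlinarith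
      positivity
    linarith
  calc _ ≤ Real.exp ((1 - lam) / 4 * ‖x‖ ^ 2) * 1 := by gcongr
    _ = _ := mul_one _

/-! ### The Laplacian and `L + λM` of a `C²_c` function -/

/-- The Laplacian on `ℝ²` in coordinates for a `C²` function: `Δφ = ∂₀∂₀φ + ∂₁∂₁φ` (private copy of
the Summits-side `laplacian_eq_fin_two_of_contDiff_two`, not importable from Literature).
[folklore] -/
private theorem laplacian_eq_fin_two_of_contDiff_two' {φ : EuclideanSpace ℝ (Fin 2) → ℝ}
    (hφ : ContDiff ℝ 2 φ) (x : EuclideanSpace ℝ (Fin 2)) :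
    Δ φ x = fderiv ℝ (fun y => fderiv ℝ φ y (EuclideanSpace.single 0 (1 : ℝ))) x
        (EuclideanSpace.single 0 (1 : ℝ)) +
      fderiv ℝ (fun y => fderiv ℝ φ y (EuclideanSpace.single 1 (1 : ℝ))) x
        (EuclideanSpace.single 1 (1 : ℝ)) := by
  have hd : DifferentiableAt ℝ (fderiv ℝ φ) x :=
    ((hφ.fderiv_right (m := 1) (by norm_num)).differentiable one_ne_zero).differentiableAt
  have hkey : ∀ v : EuclideanSpace ℝ (Fin 2),
      fderiv ℝ (fun y => fderiv ℝ φ y v) x v = fderiv ℝ (fderiv ℝ φ) x v v := by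
    intro v
    rw [fderiv_clm_apply hd (differentiableAt_const v)]
    simp
  rw [InnerProductSpace.laplacian_eq_iteratedFDeriv_orthonormalBasis φ
    (EuclideanSpace.basisFun (Fin 2) ℝ)]
  simp only [Fin.sum_univ_two, EuclideanSpace.basisFun_apply, iteratedFDeriv_two_apply, hkey]
  rfl

section Operator

variable {w : EuclideanSpace ℝ (Fin 2) → ℝ} (hw : ContDiff ℝ 2 w) (hwc : HasCompactSupport w)
include hw

/-- Second partials of a `C²` function are continuous. [folklore] -/
theorem continuous_fderiv_fderiv_of_contDiff_two (u v : EuclideanSpace ℝ (Fin 2)) :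
    Continuous fun x => fderiv ℝ (fun y => fderiv ℝ w y u) x v :=
  (((hw.fderiv_right (m := 1) (by norm_num)).clm_apply contDiff_const).continuous_fderiv
    one_ne_zero).clm_apply continuous_const

/-- `L_λ w` is continuous for `w ∈ C²`. [folklore] -/
theorem continuous_strainedVorticityOperator_of_contDiff_two (lam : ℝ) :
    Continuous (strainedVorticityOperator lam w) := by
  have hw1 : ContDiff ℝ 1 w := hw.of_le one_le_two
  have hΔ : (Δ w) = fun x => fderiv ℝ (fun y => fderiv ℝ w y (EuclideanSpace.single 0 (1 : ℝ))) x
        (EuclideanSpace.single 0 (1 : ℝ)) +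
      fderiv ℝ (fun y => fderiv ℝ w y (EuclideanSpace.single 1 (1 : ℝ))) x
        (EuclideanSpace.single 1 (1 : ℝ)) := funext (laplacian_eq_fin_two_of_contDiff_two' hw)
  have hpj : ∀ j : Fin 2, Continuous fun x : EuclideanSpace ℝ (Fin 2) => x j := fun j =>
    (EuclideanSpace.proj (j : Fin 2) : EuclideanSpace ℝ (Fin 2) →L[ℝ] ℝ).continuous
  have hd : ∀ v : EuclideanSpace ℝ (Fin 2), Continuous fun x => fderiv ℝ w x v := fun v =>
    (hw1.continuous_fderiv one_ne_zero).clm_apply continuous_const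
  unfold strainedVorticityOperator
  rw [hΔ]
  exact ((((continuous_fderiv_fderiv_of_contDiff_two hw _ _).add
    (continuous_fderiv_fderiv_of_contDiff_two hw _ _)).add
    ((continuous_const.mul (hpj 0)).mul (hd _))).add
    ((continuous_const.mul (hpj 1)).mul (hd _))).add hw.continuous

include hwc in
/-- `L_λ w` has compact support for `w ∈ C²_c`. [folklore] -/
theorem hasCompactSupport_strainedVorticityOperator (lam : ℝ) :
    HasCompactSupport (strainedVorticityOperator lam w) := by
  have hΔ : (Δ w) = fun x => fderiv ℝ (fun y => fderiv ℝ w y (EuclideanSpace.single 0 (1 : ℝ))) x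
        (EuclideanSpace.single 0 (1 : ℝ)) +
      fderiv ℝ (fun y => fderiv ℝ w y (EuclideanSpace.single 1 (1 : ℝ))) x
        (EuclideanSpace.single 1 (1 : ℝ)) := funext (laplacian_eq_fin_two_of_contDiff_two' hw)
  have h2 : ∀ v : EuclideanSpace ℝ (Fin 2),
      HasCompactSupport fun x => fderiv ℝ (fun y => fderiv ℝ w y v) x v := fun v =>
    (hwc.fderiv_apply (𝕜 := ℝ) v).fderiv_apply (𝕜 := ℝ) v
  have h1 : ∀ (v : EuclideanSpace ℝ (Fin 2)) (c : EuclideanSpace ℝ (Fin 2) → ℝ),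
      HasCompactSupport fun x => c x * fderiv ℝ w x v := fun v c =>
    (hwc.fderiv_apply (𝕜 := ℝ) v).mul_left
  unfold strainedVorticityOperator
  rw [hΔ]
  refine (((((h2 _).add (h2 _)).add ?_).add ?_).add hwc)
  · simpa [mul_assoc] using h1 (EuclideanSpace.single 0 1) (fun x => (1 + lam) / 2 * x 0)
  · simpa [mul_assoc] using h1 (EuclideanSpace.single 1 1) (fun x => (1 - lam) / 2 * x 1)

end Operator

/-! ### Weighted Cauchy–Schwarz -/

/-- `|∫ p A B| ≤ √(∫ p A²) √(∫ p B²)` for a non-negative weight and measurable `A, B` with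
`p A², p B²` integrable. [folklore] -/
theorem abs_integral_gaussWeight_mul_mul_le_sqrt {p A B : EuclideanSpace ℝ (Fin 2) → ℝ}
    (hp0 : ∀ x, 0 ≤ p x) (hpm : Measurable p) (hAm : Measurable A) (hBm : Measurable B)
    (hA : Integrable fun x => p x * A x ^ 2) (hB : Integrable fun x => p x * B x ^ 2) :
    |∫ x, p x * A x * B x| ≤ Real.sqrt (∫ x, p x * A x ^ 2) * Real.sqrt (∫ x, p x * B x ^ 2) := by
  have h1 : |∫ x, p x * A x * B x| ≤ ∫ x, |p x * A x * B x| := abs_integral_le_integral_abs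
  have h2 : (fun x => |p x * A x * B x|) = fun x => Real.sqrt ((p x * A x ^ 2) * (p x * B x ^ 2)) := by
    funext x
    have : (p x * A x ^ 2) * (p x * B x ^ 2) = (p x * A x * B x) ^ 2 := by ring
    rw [this, Real.sqrt_sq_eq_abs]
  rw [h2] at h1
  have h3 := sq_integral_sqrt_mul_le (μ := volume) (fun x => mul_nonneg (hp0 x) (sq_nonneg _))
    (fun x => mul_nonneg (hp0 x) (sq_nonneg _)) (hpm.mul (hAm.pow_const 2))
    (hpm.mul (hBm.pow_const 2)) hA hB
  have hI0 : 0 ≤ ∫ x, Real.sqrt ((p x * A x ^ 2) * (p x * B x ^ 2)) :=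
    integral_nonneg fun x => Real.sqrt_nonneg _
  have hA0 : 0 ≤ ∫ x, p x * A x ^ 2 := integral_nonneg fun x => mul_nonneg (hp0 x) (sq_nonneg _)
  have hB0 : 0 ≤ ∫ x, p x * B x ^ 2 := integral_nonneg fun x => mul_nonneg (hp0 x) (sq_nonneg _)
  refine h1.trans ?_
  calc ∫ x, Real.sqrt ((p x * A x ^ 2) * (p x * B x ^ 2))
      = Real.sqrt ((∫ x, Real.sqrt ((p x * A x ^ 2) * (p x * B x ^ 2))) ^ 2) :=
        (Real.sqrt_sq hI0).symm
    _ ≤ Real.sqrt ((∫ x, p x * A x ^ 2) * ∫ x, p x * B x ^ 2) := Real.sqrt_le_sqrt h3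
    _ = _ := Real.sqrt_mul hA0 _

/-! ### Uniform weights: the Gaussian-weighted potential bounds with weight `p` -/

section Weights

variable {a : ℝ} (ha2 : a < 2)
include ha2

/-- `p Φ² ≤ K e^{−(2−a)|x|²/8}`. [folklore] -/
theorem exists_gaussWeight_kerWeight_sq_le :
    ∃ K, 0 ≤ K ∧ ∀ x : EuclideanSpace ℝ (Fin 2),
      Real.exp (a / 4 * ‖x‖ ^ 2) * kerWeight ‖x‖ ^ 2 ≤
        K * Real.exp (-((2 - a) / 4 / 2 * ‖x‖ ^ 2)) := by
  have hc : 0 < (2 - a) / 4 := by linarith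
  obtain ⟨K, hK0, hK⟩ := exists_one_add_pow_mul_exp_neg_le hc 4
  obtain ⟨CΦ, -, hCΦ⟩ := exists_kerWeight_norm_gauss_bound
  refine ⟨K, hK0.le, fun x => le_trans ?_ (hK ‖x‖ (norm_nonneg x))⟩
  have h := (hCΦ x).1
  calc Real.exp (a / 4 * ‖x‖ ^ 2) * kerWeight ‖x‖ ^ 2
      ≤ Real.exp (a / 4 * ‖x‖ ^ 2) * ((1 + ‖x‖) ^ 2 * Real.exp (-(‖x‖ ^ 2 / 4))) ^ 2 := by
        gcongr; exact (kerWeight_pos _).le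
    _ = (1 + ‖x‖) ^ 4 * (Real.exp (a / 4 * ‖x‖ ^ 2) * Real.exp (-(‖x‖ ^ 2 / 4)) *
        Real.exp (-(‖x‖ ^ 2 / 4))) := by ring
    _ = (1 + ‖x‖) ^ 4 * Real.exp (-((2 - a) / 4 * ‖x‖ ^ 2)) := by
        rw [← Real.exp_add, ← Real.exp_add]; ring_nf

/-- `p Φ² |x|² ≤ K e^{−(2−a)|x|²/8}`. [folklore] -/
theorem exists_gaussWeight_kerWeight_sq_norm_sq_le :
    ∃ K, 0 ≤ K ∧ ∀ x : EuclideanSpace ℝ (Fin 2),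
      Real.exp (a / 4 * ‖x‖ ^ 2) * kerWeight ‖x‖ ^ 2 * ‖x‖ ^ 2 ≤
        K * Real.exp (-((2 - a) / 4 / 2 * ‖x‖ ^ 2)) := by
  have hc : 0 < (2 - a) / 4 := by linarith
  obtain ⟨K, hK0, hK⟩ := exists_one_add_pow_mul_exp_neg_le hc 6
  obtain ⟨CΦ, -, hCΦ⟩ := exists_kerWeight_norm_gauss_bound
  refine ⟨K, hK0.le, fun x => le_trans ?_ (hK ‖x‖ (norm_nonneg x))⟩
  have h := (hCΦ x).1
  have hr : ‖x‖ ^ 2 ≤ (1 + ‖x‖) ^ 2 := by nlinarith [norm_nonneg x]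
  calc Real.exp (a / 4 * ‖x‖ ^ 2) * kerWeight ‖x‖ ^ 2 * ‖x‖ ^ 2
      ≤ Real.exp (a / 4 * ‖x‖ ^ 2) * ((1 + ‖x‖) ^ 2 * Real.exp (-(‖x‖ ^ 2 / 4))) ^ 2 *
          (1 + ‖x‖) ^ 2 := by
        gcongr; exact (kerWeight_pos _).le
    _ = (1 + ‖x‖) ^ 6 * (Real.exp (a / 4 * ‖x‖ ^ 2) * Real.exp (-(‖x‖ ^ 2 / 4)) *
        Real.exp (-(‖x‖ ^ 2 / 4))) := by ring
    _ = (1 + ‖x‖) ^ 6 * Real.exp (-((2 - a) / 4 * ‖x‖ ^ 2)) := by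
        rw [← Real.exp_add, ← Real.exp_add]; ring_nf

/-- `p ‖DΦ‖² ≤ K e^{−(2−a)|x|²/8}`. [folklore] -/
theorem exists_gaussWeight_norm_fderiv_kerWeight_sq_le :
    ∃ K, 0 ≤ K ∧ ∀ x : EuclideanSpace ℝ (Fin 2),
      Real.exp (a / 4 * ‖x‖ ^ 2) *
          ‖fderiv ℝ (fun y : EuclideanSpace ℝ (Fin 2) => kerWeight ‖y‖) x‖ ^ 2 ≤
        K * Real.exp (-((2 - a) / 4 / 2 * ‖x‖ ^ 2)) := by
  have hc : 0 < (2 - a) / 4 := by linarith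
  obtain ⟨K, hK0, hK⟩ := exists_one_add_pow_mul_exp_neg_le hc 10
  obtain ⟨CΦ, hCΦ0, hCΦ⟩ := exists_kerWeight_norm_gauss_bound
  refine ⟨CΦ ^ 2 * K, by positivity, fun x => ?_⟩
  have h := (hCΦ x).2
  calc Real.exp (a / 4 * ‖x‖ ^ 2) *
        ‖fderiv ℝ (fun y : EuclideanSpace ℝ (Fin 2) => kerWeight ‖y‖) x‖ ^ 2
      ≤ Real.exp (a / 4 * ‖x‖ ^ 2) * (CΦ * (1 + ‖x‖) ^ 5 * Real.exp (-(‖x‖ ^ 2 / 4))) ^ 2 := by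
        gcongr
    _ = CΦ ^ 2 * ((1 + ‖x‖) ^ 10 * (Real.exp (a / 4 * ‖x‖ ^ 2) * Real.exp (-(‖x‖ ^ 2 / 4)) *
        Real.exp (-(‖x‖ ^ 2 / 4)))) := by ring
    _ = CΦ ^ 2 * ((1 + ‖x‖) ^ 10 * Real.exp (-((2 - a) / 4 * ‖x‖ ^ 2))) := by
        rw [← Real.exp_add, ← Real.exp_add]; ring_nf
    _ ≤ CΦ ^ 2 * (K * Real.exp (-((2 - a) / 4 / 2 * ‖x‖ ^ 2))) :=
        mul_le_mul_of_nonneg_left (hK ‖x‖ (norm_nonneg x)) (sq_nonneg _)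
    _ = _ := by ring

end Weights

/-- `∫ e^{a|x|²/8} g² ≤ ∫ e^{a|x|²/4} g²` (`a ≥ 0`, `g` continuous with compact support).
[folklore] -/
theorem integral_exp_eighth_mul_sq_le {a : ℝ} (ha0 : 0 ≤ a) {g : EuclideanSpace ℝ (Fin 2) → ℝ}
    (hg : Continuous g) (hgc : HasCompactSupport g) :
    Integrable (fun x : EuclideanSpace ℝ (Fin 2) => Real.exp (a / 4 * ‖x‖ ^ 2) * g x ^ 2) ∧
    ∫ x : EuclideanSpace ℝ (Fin 2), Real.exp (a / 8 * ‖x‖ ^ 2) * g x ^ 2 ≤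
      ∫ x, Real.exp (a / 4 * ‖x‖ ^ 2) * g x ^ 2 := by
  have hg2 : HasCompactSupport fun x => g x ^ 2 := hgc.comp_left (g := fun t : ℝ => t ^ 2) (by simp)
  have hpg : Integrable fun x : EuclideanSpace ℝ (Fin 2) => Real.exp (a / 4 * ‖x‖ ^ 2) * g x ^ 2 :=
    ((contDiff_gaussWeightExp a (n := 0)).continuous.mul (hg.pow 2)).integrable_of_hasCompactSupport
      hg2.mul_left
  have hqg : Integrable fun x : EuclideanSpace ℝ (Fin 2) => Real.exp (a / 8 * ‖x‖ ^ 2) * g x ^ 2 := by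
    have : Integrable fun x : EuclideanSpace ℝ (Fin 2) => Real.exp (a / 2 / 4 * ‖x‖ ^ 2) * g x ^ 2 :=
      ((contDiff_gaussWeightExp (a / 2) (n := 0)).continuous.mul (hg.pow 2))
        |>.integrable_of_hasCompactSupport (μ := volume) hg2.mul_left
    refine this.congr (Eventually.of_forall fun x => ?_)
    simp only; ring_nf
  refine ⟨hpg, integral_mono hqg hpg fun x => ?_⟩
  have : Real.exp (a / 8 * ‖x‖ ^ 2) ≤ Real.exp (a / 4 * ‖x‖ ^ 2) :=
    Real.exp_le_exp.2 (by nlinarith [sq_nonneg ‖x‖])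
  exact mul_le_mul_of_nonneg_right this (sq_nonneg _)

/-- **The potential bounds in `L²(p)`.** For `λ ∈ [0,1)`, `a = 1 − λ`, `p = e^{a|x|²/4}`,
`Φ = kerWeight |x|`: there is `C₁ = C₁(λ)` such that for every continuous compactly supported `g`
with potentials `ψ = N ∗ g`, `v = K_{2D} ∗ g`, the four functions `pΦ²ψ²`, `pΦ²|x|²ψ²`,
`p‖DΦ‖²ψ²`, `pΦ²|v|²` are integrable with integrals `≤ C₁ ∫ p g²`. [folklore] -/
theorem exists_gaussWeight_potential_bounds {lam : ℝ} (hlam0 : 0 ≤ lam) (hlam1 : lam < 1) :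
    ∃ C₁, 0 ≤ C₁ ∧ ∀ g : EuclideanSpace ℝ (Fin 2) → ℝ, Continuous g → HasCompactSupport g →
      (Integrable (fun x => Real.exp ((1 - lam) / 4 * ‖x‖ ^ 2) * kerWeight ‖x‖ ^ 2 *
          (∫ y, g y * ((2 * π)⁻¹ * Real.log ‖x - y‖)) ^ 2) ∧
        ∫ x, Real.exp ((1 - lam) / 4 * ‖x‖ ^ 2) * kerWeight ‖x‖ ^ 2 *
          (∫ y, g y * ((2 * π)⁻¹ * Real.log ‖x - y‖)) ^ 2 ≤
          C₁ * ∫ x, Real.exp ((1 - lam) / 4 * ‖x‖ ^ 2) * g x ^ 2) ∧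
      (Integrable (fun x => Real.exp ((1 - lam) / 4 * ‖x‖ ^ 2) * kerWeight ‖x‖ ^ 2 * ‖x‖ ^ 2 *
          (∫ y, g y * ((2 * π)⁻¹ * Real.log ‖x - y‖)) ^ 2) ∧
        ∫ x, Real.exp ((1 - lam) / 4 * ‖x‖ ^ 2) * kerWeight ‖x‖ ^ 2 * ‖x‖ ^ 2 *
          (∫ y, g y * ((2 * π)⁻¹ * Real.log ‖x - y‖)) ^ 2 ≤
          C₁ * ∫ x, Real.exp ((1 - lam) / 4 * ‖x‖ ^ 2) * g x ^ 2) ∧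
      (Integrable (fun x => Real.exp ((1 - lam) / 4 * ‖x‖ ^ 2) *
          ‖fderiv ℝ (fun y : EuclideanSpace ℝ (Fin 2) => kerWeight ‖y‖) x‖ ^ 2 *
          (∫ y, g y * ((2 * π)⁻¹ * Real.log ‖x - y‖)) ^ 2) ∧
        ∫ x, Real.exp ((1 - lam) / 4 * ‖x‖ ^ 2) *
          ‖fderiv ℝ (fun y : EuclideanSpace ℝ (Fin 2) => kerWeight ‖y‖) x‖ ^ 2 *
          (∫ y, g y * ((2 * π)⁻¹ * Real.log ‖x - y‖)) ^ 2 ≤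
          C₁ * ∫ x, Real.exp ((1 - lam) / 4 * ‖x‖ ^ 2) * g x ^ 2) ∧
      (Integrable (fun x => Real.exp ((1 - lam) / 4 * ‖x‖ ^ 2) * kerWeight ‖x‖ ^ 2 *
          ‖biotSavart2D g x‖ ^ 2) ∧
        ∫ x, Real.exp ((1 - lam) / 4 * ‖x‖ ^ 2) * kerWeight ‖x‖ ^ 2 * ‖biotSavart2D g x‖ ^ 2 ≤
          C₁ * ∫ x, Real.exp ((1 - lam) / 4 * ‖x‖ ^ 2) * g x ^ 2) := by
  have ha0 : 0 ≤ 1 - lam := by linarith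
  have ha2 : 1 - lam < 2 := by linarith
  have hβ : 0 < (2 - (1 - lam)) / 4 / 2 := by linarith
  have hc8 : 0 < (1 - lam) / 8 := by linarith
  have hΦc : Continuous fun x : EuclideanSpace ℝ (Fin 2) => kerWeight ‖x‖ :=
    continuous_kerWeight.comp continuous_norm
  have hpc : Continuous fun x : EuclideanSpace ℝ (Fin 2) => Real.exp ((1 - lam) / 4 * ‖x‖ ^ 2) :=
    (contDiff_gaussWeightExp (1 - lam) (n := 0)).continuous
  have hW₁c : Continuous fun x : EuclideanSpace ℝ (Fin 2) =>
      Real.exp ((1 - lam) / 4 * ‖x‖ ^ 2) * kerWeight ‖x‖ ^ 2 := hpc.mul (hΦc.pow 2)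
  have hW₂c : Continuous fun x : EuclideanSpace ℝ (Fin 2) =>
      Real.exp ((1 - lam) / 4 * ‖x‖ ^ 2) * kerWeight ‖x‖ ^ 2 * ‖x‖ ^ 2 :=
    (hpc.mul (hΦc.pow 2)).mul (continuous_norm.pow 2)
  have hW₃c : Continuous fun x : EuclideanSpace ℝ (Fin 2) => Real.exp ((1 - lam) / 4 * ‖x‖ ^ 2) *
      ‖fderiv ℝ (fun y : EuclideanSpace ℝ (Fin 2) => kerWeight ‖y‖) x‖ ^ 2 :=
    hpc.mul ((contDiff_kerWeight_norm.continuous_fderiv one_ne_zero).norm.pow 2)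
  obtain ⟨K₁, -, hK₁⟩ := exists_gaussWeight_kerWeight_sq_le ha2
  obtain ⟨K₂, -, hK₂⟩ := exists_gaussWeight_kerWeight_sq_norm_sq_le ha2
  obtain ⟨K₃, -, hK₃⟩ := exists_gaussWeight_norm_fderiv_kerWeight_sq_le ha2
  obtain ⟨D₁, hD₁0, hD₁⟩ := exists_integral_mul_sq_logPotential_le hW₁c (fun x => by positivity)
    hK₁ hβ hc8
  obtain ⟨D₂, hD₂0, hD₂⟩ := exists_integral_mul_sq_logPotential_le hW₂c (fun x => by positivity)
    hK₂ hβ hc8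
  obtain ⟨D₃, hD₃0, hD₃⟩ := exists_integral_mul_sq_logPotential_le hW₃c (fun x => by positivity)
    hK₃ hβ hc8
  obtain ⟨D₄, hD₄0, hD₄⟩ := exists_integral_mul_norm_sq_biotSavart2D_le hW₁c
    (fun x => by positivity) hK₁ hβ hc8
  refine ⟨D₁ + D₂ + D₃ + D₄, by positivity, fun g hg hgc => ?_⟩
  obtain ⟨-, hqp⟩ := integral_exp_eighth_mul_sq_le ha0 hg hgc
  have hN0 : 0 ≤ ∫ x : EuclideanSpace ℝ (Fin 2), Real.exp ((1 - lam) / 4 * ‖x‖ ^ 2) * g x ^ 2 :=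
    integral_nonneg fun x => by positivity
  have hmono : ∀ {D I : ℝ}, 0 ≤ D → D ≤ D₁ + D₂ + D₃ + D₄ →
      I ≤ D * ∫ x : EuclideanSpace ℝ (Fin 2), Real.exp ((1 - lam) / 8 * ‖x‖ ^ 2) * g x ^ 2 →
      I ≤ (D₁ + D₂ + D₃ + D₄) * ∫ x, Real.exp ((1 - lam) / 4 * ‖x‖ ^ 2) * g x ^ 2 := by
    intro D I hD hDle hI
    exact hI.trans ((mul_le_mul_of_nonneg_left hqp hD).trans
      (mul_le_mul_of_nonneg_right hDle hN0))
  obtain ⟨i1, b1⟩ := hD₁ g hg hgc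
  obtain ⟨i2, b2⟩ := hD₂ g hg hgc
  obtain ⟨i3, b3⟩ := hD₃ g hg hgc
  obtain ⟨i4, b4⟩ := hD₄ g hg hgc
  exact ⟨⟨i1, hmono hD₁0 (by linarith) b1⟩, ⟨i2, hmono hD₂0 (by linarith) b2⟩,
    ⟨i3, hmono hD₃0 (by linarith) b3⟩, ⟨i4, hmono hD₄0 (by linarith) b4⟩⟩

/-! ### The linearised Biot–Savart term `Λw` along the corrected vorticity -/

section Lambda

variable {w : EuclideanSpace ℝ (Fin 2) → ℝ} (hw : ContDiff ℝ 2 w) (hwc : HasCompactSupport w)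
include hw hwc

/-- `Λw = (G/(2Φ)) ∂_θ(w + Φψ)` pointwise, for the logarithmic potential `ψ = N ∗ w`
(`gaussLambda_eq_mul_fderiv_perp` with `∇ψ = −v^⊥`). [cite: Maekawa2009b, Lemma 1.1] -/
theorem gaussLambda_eq_omega_mul_fderiv_corrected_perp (x : EuclideanSpace ℝ (Fin 2)) :
    ⟪gaussVortexVelocity x, gradient w x⟫ + ⟪biotSavart2D w x, gradient gaussVortexProfile x⟫ =
      gaussVortexProfile x / (2 * kerWeight ‖x‖) *
        fderiv ℝ (fun y => w y + kerWeight ‖y‖ * ∫ z, w z * ((2 * π)⁻¹ * Real.log ‖y - z‖)) x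
          (perp x) := by
  have hw1 : ContDiff ℝ 1 w := hw.of_le one_le_two
  refine gaussLambda_eq_mul_fderiv_perp ((hw1.differentiable one_ne_zero) x)
    (((contDiff_logPotential (n := 1) hw1 hwc).differentiable one_ne_zero) x) ?_
  rw [fderiv_logPotential_eq hw1 hwc, inner_perp_perp]

/-- `Λw` is continuous for `w ∈ C²_c`. [folklore] -/
theorem continuous_gaussLambda :
    Continuous fun x => ⟪gaussVortexVelocity x, gradient w x⟫ +
      ⟪biotSavart2D w x, gradient gaussVortexProfile x⟫ := by
  have h : (fun x => ⟪gaussVortexVelocity x, gradient w x⟫ +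
      ⟪biotSavart2D w x, gradient gaussVortexProfile x⟫) = fun x =>
      gaussVortexProfile x / (2 * kerWeight ‖x‖) *
        fderiv ℝ (fun y => w y + kerWeight ‖y‖ * ∫ z, w z * ((2 * π)⁻¹ * Real.log ‖y - z‖)) x
          (perp x) := funext (gaussLambda_eq_omega_mul_fderiv_corrected_perp hw hwc)
  rw [h]
  have hu1 := contDiff_one_corrected hw hwc
  exact ((contDiff_gaussVortexProfile (n := 0)).continuous.div (continuous_const.mul
    (continuous_kerWeight.comp continuous_norm)) fun x =>
      mul_ne_zero two_ne_zero (kerWeight_pos _).ne').mul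
    ((hu1.continuous_fderiv one_ne_zero).clm_apply continuous_perp)

/-- **Gaussian decay of `Λw`**: `|Λw(x)| ≤ C (1+|x|)⁷ e^{−|x|²/4}`. [folklore] -/
theorem exists_gaussLambda_bound :
    ∃ C, 0 ≤ C ∧ ∀ x, |⟪gaussVortexVelocity x, gradient w x⟫ +
      ⟪biotSavart2D w x, gradient gaussVortexProfile x⟫| ≤
        C * (1 + ‖x‖) ^ 7 * Real.exp (-(‖x‖ ^ 2 / 4)) := by
  obtain ⟨Cu, hCu0, hCu⟩ := exists_corrected_gauss_bound hw hwc
  refine ⟨(8 * π)⁻¹ * Cu, by positivity, fun x => ?_⟩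
  rw [gaussLambda_eq_omega_mul_fderiv_corrected_perp hw hwc x, abs_mul]
  obtain ⟨hΩ0, hΩ⟩ := gaussVortexProfile_div_two_mul_kerWeight_le x
  obtain ⟨-, hu'⟩ := hCu x
  have h1 : |fderiv ℝ (fun y => w y + kerWeight ‖y‖ * ∫ z, w z * ((2 * π)⁻¹ * Real.log ‖y - z‖))
      x (perp x)| ≤ Cu * (1 + ‖x‖) ^ 6 * Real.exp (-(‖x‖ ^ 2 / 4)) * ‖x‖ := by
    rw [← Real.norm_eq_abs]
    refine (ContinuousLinearMap.le_opNorm _ _).trans ?_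
    rw [norm_perp]
    exact mul_le_mul_of_nonneg_right hu' (norm_nonneg _)
  have hr : ‖x‖ ≤ 1 + ‖x‖ := by linarith [norm_nonneg x]
  rw [abs_of_pos hΩ0]
  calc _ ≤ (8 * π)⁻¹ * (Cu * (1 + ‖x‖) ^ 6 * Real.exp (-(‖x‖ ^ 2 / 4)) * ‖x‖) :=
        mul_le_mul hΩ h1 (abs_nonneg _) (by positivity)
    _ ≤ (8 * π)⁻¹ * (Cu * (1 + ‖x‖) ^ 6 * Real.exp (-(‖x‖ ^ 2 / 4)) * (1 + ‖x‖)) := by gcongr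
    _ = _ := by ring

/-- `p (Λw) u` and `p (Λw)²` are integrable for `p = e^{a|x|²/4}`, `a < 2`. [folklore] -/
theorem integrable_gaussWeight_mul_gaussLambda {a : ℝ} (ha2 : a < 2) :
    Integrable (fun x => Real.exp (a / 4 * ‖x‖ ^ 2) *
      (⟪gaussVortexVelocity x, gradient w x⟫ + ⟪biotSavart2D w x, gradient gaussVortexProfile x⟫) *
      (w x + kerWeight ‖x‖ * ∫ y, w y * ((2 * π)⁻¹ * Real.log ‖x - y‖))) ∧
    Integrable (fun x => Real.exp (a / 4 * ‖x‖ ^ 2) *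
      (⟪gaussVortexVelocity x, gradient w x⟫ +
        ⟪biotSavart2D w x, gradient gaussVortexProfile x⟫) ^ 2) := by
  obtain ⟨CΛ, hCΛ0, hCΛ⟩ := exists_gaussLambda_bound hw hwc
  obtain ⟨Cu, hCu0, hCu⟩ := exists_corrected_gauss_bound hw hwc
  have hμ : (a - 2) / 4 < 0 := by linarith
  have hpc : Continuous fun x : EuclideanSpace ℝ (Fin 2) => Real.exp (a / 4 * ‖x‖ ^ 2) :=
    (contDiff_gaussWeightExp a (n := 0)).continuous
  have hΛc := continuous_gaussLambda hw hwc
  have huc := (contDiff_one_corrected hw hwc).continuous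
  have hexp3 : ∀ x : EuclideanSpace ℝ (Fin 2), Real.exp (a / 4 * ‖x‖ ^ 2) *
      Real.exp (-(‖x‖ ^ 2 / 4)) * Real.exp (-(‖x‖ ^ 2 / 4)) =
      Real.exp ((a - 2) / 4 * ‖x‖ ^ 2) := fun x => by
    rw [← Real.exp_add, ← Real.exp_add]; ring_nf
  constructor
  · refine integrable_of_norm_le_poly_mul_gauss (C := CΛ * Cu) (N := 10)
      ((hpc.mul hΛc).mul huc).aestronglyMeasurable hμ fun x => ?_
    obtain ⟨hux, -⟩ := hCu x
    rw [Real.norm_eq_abs, abs_mul, abs_mul, abs_of_pos (Real.exp_pos _)]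
    calc _ ≤ Real.exp (a / 4 * ‖x‖ ^ 2) * (CΛ * (1 + ‖x‖) ^ 7 * Real.exp (-(‖x‖ ^ 2 / 4))) *
          (Cu * (1 + ‖x‖) ^ 3 * Real.exp (-(‖x‖ ^ 2 / 4))) := by gcongr; exact hCΛ x
      _ = CΛ * Cu * (1 + ‖x‖) ^ 10 * (Real.exp (a / 4 * ‖x‖ ^ 2) *
          Real.exp (-(‖x‖ ^ 2 / 4)) * Real.exp (-(‖x‖ ^ 2 / 4))) := by ring
      _ = _ := by rw [hexp3]
  · refine integrable_of_norm_le_poly_mul_gauss (C := CΛ ^ 2) (N := 14)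
      (hpc.mul (hΛc.pow 2)).aestronglyMeasurable hμ fun x => ?_
    rw [Real.norm_eq_abs, abs_mul, abs_of_pos (Real.exp_pos _), abs_of_nonneg (sq_nonneg _)]
    have hsq : (⟪gaussVortexVelocity x, gradient w x⟫ +
        ⟪biotSavart2D w x, gradient gaussVortexProfile x⟫) ^ 2 ≤
        (CΛ * (1 + ‖x‖) ^ 7 * Real.exp (-(‖x‖ ^ 2 / 4))) ^ 2 := by
      have := pow_le_pow_left₀ (abs_nonneg _) (hCΛ x) 2
      rwa [sq_abs] at this
    calc _ ≤ Real.exp (a / 4 * ‖x‖ ^ 2) * (CΛ * (1 + ‖x‖) ^ 7 * Real.exp (-(‖x‖ ^ 2 / 4))) ^ 2 :=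
          mul_le_mul_of_nonneg_left hsq (Real.exp_pos _).le
      _ = CΛ ^ 2 * (1 + ‖x‖) ^ 14 * (Real.exp (a / 4 * ‖x‖ ^ 2) *
          Real.exp (-(‖x‖ ^ 2 / 4)) * Real.exp (-(‖x‖ ^ 2 / 4))) := by ring
      _ = _ := by rw [hexp3]

/-- **The test identity.** For `f = L_λ w − αΛw` and `u = w + Φψ`:
`∫ p w (L_λ w) = ∫ p u f − ∫ p (Φψ) (L_λ w)` (`0 ≤ a ≤ 1`): the circulation term drops out by
the weighted skew identity `∫ p (Λw) u = 0`. [cite: Maekawa2009b, Prop. 4.1] -/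
theorem integral_gaussWeight_mul_mul_strained_eq {a : ℝ} (ha0 : 0 ≤ a) (ha1 : a ≤ 1)
    (lam α : ℝ) :
    ∫ x, Real.exp (a / 4 * ‖x‖ ^ 2) * w x * strainedVorticityOperator lam w x =
      (∫ x, Real.exp (a / 4 * ‖x‖ ^ 2) *
        (w x + kerWeight ‖x‖ * ∫ y, w y * ((2 * π)⁻¹ * Real.log ‖x - y‖)) *
        (strainedVorticityOperator lam w x - α * (⟪gaussVortexVelocity x, gradient w x⟫ +
          ⟪biotSavart2D w x, gradient gaussVortexProfile x⟫))) -
      ∫ x, Real.exp (a / 4 * ‖x‖ ^ 2) *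
        (kerWeight ‖x‖ * ∫ y, w y * ((2 * π)⁻¹ * Real.log ‖x - y‖)) *
        strainedVorticityOperator lam w x := by
  have hskew := integral_gaussWeight_mul_gaussLambda_mul_eq_zero hw hwc ha0 ha1
  obtain ⟨hiΛ, -⟩ := integrable_gaussWeight_mul_gaussLambda hw hwc (by linarith : a < 2)
  have hpc : Continuous fun x : EuclideanSpace ℝ (Fin 2) => Real.exp (a / 4 * ‖x‖ ^ 2) :=
    (contDiff_gaussWeightExp a (n := 0)).continuous
  have huc := (contDiff_one_corrected hw hwc).continuous
  have hAc := continuous_strainedVorticityOperator_of_contDiff_two hw lam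
  have hAs := hasCompactSupport_strainedVorticityOperator hw hwc lam
  have hΦψc : Continuous fun x : EuclideanSpace ℝ (Fin 2) =>
      kerWeight ‖x‖ * ∫ y, w y * ((2 * π)⁻¹ * Real.log ‖x - y‖) :=
    (continuous_kerWeight.comp continuous_norm).mul
      (contDiff_logPotential (n := 0) (hw.of_le (by norm_num)) hwc).continuous
  have i1 : Integrable fun x => Real.exp (a / 4 * ‖x‖ ^ 2) *
      (w x + kerWeight ‖x‖ * ∫ y, w y * ((2 * π)⁻¹ * Real.log ‖x - y‖)) *
      strainedVorticityOperator lam w x :=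
    ((hpc.mul huc).mul hAc).integrable_of_hasCompactSupport hAs.mul_left
  have i2 : Integrable fun x => Real.exp (a / 4 * ‖x‖ ^ 2) * w x *
      strainedVorticityOperator lam w x :=
    ((hpc.mul hw.continuous).mul hAc).integrable_of_hasCompactSupport hAs.mul_left
  have i3 : Integrable fun x => Real.exp (a / 4 * ‖x‖ ^ 2) *
      (kerWeight ‖x‖ * ∫ y, w y * ((2 * π)⁻¹ * Real.log ‖x - y‖)) *
      strainedVorticityOperator lam w x :=
    ((hpc.mul hΦψc).mul hAc).integrable_of_hasCompactSupport hAs.mul_left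
  -- `∫ p u f = ∫ p u Aw − α ∫ p Λ u = ∫ p u Aw`
  have h1 : (∫ x, Real.exp (a / 4 * ‖x‖ ^ 2) *
        (w x + kerWeight ‖x‖ * ∫ y, w y * ((2 * π)⁻¹ * Real.log ‖x - y‖)) *
        (strainedVorticityOperator lam w x - α * (⟪gaussVortexVelocity x, gradient w x⟫ +
          ⟪biotSavart2D w x, gradient gaussVortexProfile x⟫))) =
      ∫ x, Real.exp (a / 4 * ‖x‖ ^ 2) *
        (w x + kerWeight ‖x‖ * ∫ y, w y * ((2 * π)⁻¹ * Real.log ‖x - y‖)) *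
        strainedVorticityOperator lam w x := by
    have : (fun x => Real.exp (a / 4 * ‖x‖ ^ 2) *
        (w x + kerWeight ‖x‖ * ∫ y, w y * ((2 * π)⁻¹ * Real.log ‖x - y‖)) *
        (strainedVorticityOperator lam w x - α * (⟪gaussVortexVelocity x, gradient w x⟫ +
          ⟪biotSavart2D w x, gradient gaussVortexProfile x⟫))) = fun x =>
        Real.exp (a / 4 * ‖x‖ ^ 2) *
          (w x + kerWeight ‖x‖ * ∫ y, w y * ((2 * π)⁻¹ * Real.log ‖x - y‖)) *
          strainedVorticityOperator lam w x -
        α * (Real.exp (a / 4 * ‖x‖ ^ 2) *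
          (⟪gaussVortexVelocity x, gradient w x⟫ +
            ⟪biotSavart2D w x, gradient gaussVortexProfile x⟫) *
          (w x + kerWeight ‖x‖ * ∫ y, w y * ((2 * π)⁻¹ * Real.log ‖x - y‖))) := by
      funext x; ring
    rw [this, integral_sub i1 (hiΛ.const_mul α), integral_const_mul, hskew, mul_zero, sub_zero]
  -- `∫ p u Aw = ∫ p w Aw + ∫ p Φψ Aw`
  have h2 : (∫ x, Real.exp (a / 4 * ‖x‖ ^ 2) *
        (w x + kerWeight ‖x‖ * ∫ y, w y * ((2 * π)⁻¹ * Real.log ‖x - y‖)) *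
        strainedVorticityOperator lam w x) =
      (∫ x, Real.exp (a / 4 * ‖x‖ ^ 2) * w x * strainedVorticityOperator lam w x) +
      ∫ x, Real.exp (a / 4 * ‖x‖ ^ 2) *
        (kerWeight ‖x‖ * ∫ y, w y * ((2 * π)⁻¹ * Real.log ‖x - y‖)) *
        strainedVorticityOperator lam w x := by
    rw [← integral_add i2 i3]
    exact integral_congr_ae (Eventually.of_forall fun x => by ring)
  rw [h1, h2]
  ring

end Lambda

/-! ### The correction term `∫ p Φψ Δw`: integration by parts and bounds -/

/-- Continuous times continuous-compactly-supported is integrable. [folklore] -/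
private theorem integrable_mul_of_hasCompactSupport {f g : EuclideanSpace ℝ (Fin 2) → ℝ}
    (hf : Continuous f) (hg : Continuous g) (hgc : HasCompactSupport g) :
    Integrable fun x => f x * g x :=
  (hf.mul hg).integrable_of_hasCompactSupport hgc.mul_left

section Correction

variable {w : EuclideanSpace ℝ (Fin 2) → ℝ} (hw : ContDiff ℝ 2 w) (hwc : HasCompactSupport w) (a : ℝ)
include hw hwc

/-- `∂ᵢ(p Φ ψ) = p ((a/2) xᵢ Φ ψ + (∂ᵢΦ) ψ + Φ ∂ᵢψ)`. [folklore] -/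
theorem fderiv_gaussWeight_mul_correction (x : EuclideanSpace ℝ (Fin 2)) (i : Fin 2) :
    fderiv ℝ (fun y : EuclideanSpace ℝ (Fin 2) => Real.exp (a / 4 * ‖y‖ ^ 2) *
        (kerWeight ‖y‖ * ∫ z, w z * ((2 * π)⁻¹ * Real.log ‖y - z‖))) x (EuclideanSpace.single i 1) =
      Real.exp (a / 4 * ‖x‖ ^ 2) * (a / 2 * x i * kerWeight ‖x‖ *
          (∫ z, w z * ((2 * π)⁻¹ * Real.log ‖x - z‖)) +
        fderiv ℝ (fun y : EuclideanSpace ℝ (Fin 2) => kerWeight ‖y‖) x (EuclideanSpace.single i 1) *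
          (∫ z, w z * ((2 * π)⁻¹ * Real.log ‖x - z‖)) +
        kerWeight ‖x‖ * fderiv ℝ (fun y => ∫ z, w z * ((2 * π)⁻¹ * Real.log ‖y - z‖)) x
          (EuclideanSpace.single i 1)) := by
  have hw1 : ContDiff ℝ 1 w := hw.of_le one_le_two
  have hψ1 : ContDiff ℝ 1 fun y => ∫ z, w z * ((2 * π)⁻¹ * Real.log ‖y - z‖) :=
    contDiff_logPotential (n := 1) hw1 hwc
  have hP := hasFDerivAt_gaussWeightExp a x
  have hΦ : HasFDerivAt (fun y : EuclideanSpace ℝ (Fin 2) => kerWeight ‖y‖)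
      (fderiv ℝ (fun y : EuclideanSpace ℝ (Fin 2) => kerWeight ‖y‖) x) x :=
    (differentiableAt_kerWeight_norm x).hasFDerivAt
  have hψ : HasFDerivAt (fun y => ∫ z, w z * ((2 * π)⁻¹ * Real.log ‖y - z‖))
      (fderiv ℝ (fun y => ∫ z, w z * ((2 * π)⁻¹ * Real.log ‖y - z‖)) x) x :=
    ((hψ1.differentiable one_ne_zero) x).hasFDerivAt
  rw [(hP.fun_mul (hΦ.fun_mul hψ)).fderiv]
  simp only [_root_.add_apply, _root_.smul_apply, smul_eq_mul, innerSL_apply_apply,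
    EuclideanSpace.inner_single_right, conj_trivial, one_mul]
  ring

/-- **Integration by parts of the correction term**:
`∫ p Φψ ∂ᵢ∂ᵢw = −∫ ∂ᵢ(pΦψ) ∂ᵢw`. [folklore] -/
theorem integral_gaussWeight_correction_mul_fderiv_fderiv (i : Fin 2) :
    ∫ x, Real.exp (a / 4 * ‖x‖ ^ 2) *
        (kerWeight ‖x‖ * ∫ z, w z * ((2 * π)⁻¹ * Real.log ‖x - z‖)) *
        fderiv ℝ (fun y => fderiv ℝ w y (EuclideanSpace.single i 1)) x (EuclideanSpace.single i 1) =
      -∫ x, Real.exp (a / 4 * ‖x‖ ^ 2) * (a / 2 * x i * kerWeight ‖x‖ *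
          (∫ z, w z * ((2 * π)⁻¹ * Real.log ‖x - z‖)) +
        fderiv ℝ (fun y : EuclideanSpace ℝ (Fin 2) => kerWeight ‖y‖) x (EuclideanSpace.single i 1) *
          (∫ z, w z * ((2 * π)⁻¹ * Real.log ‖x - z‖)) +
        kerWeight ‖x‖ * fderiv ℝ (fun y => ∫ z, w z * ((2 * π)⁻¹ * Real.log ‖y - z‖)) x
          (EuclideanSpace.single i 1)) * fderiv ℝ w x (EuclideanSpace.single i 1) := by
  have hw1 : ContDiff ℝ 1 w := hw.of_le one_le_two
  have hψ1 : ContDiff ℝ 1 fun y => ∫ z, w z * ((2 * π)⁻¹ * Real.log ‖y - z‖) :=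
    contDiff_logPotential (n := 1) hw1 hwc
  -- `f = pΦψ` is `C¹`, `g = ∂ᵢw` is `C¹` with compact support
  have hf : ContDiff ℝ 1 fun y : EuclideanSpace ℝ (Fin 2) => Real.exp (a / 4 * ‖y‖ ^ 2) *
      (kerWeight ‖y‖ * ∫ z, w z * ((2 * π)⁻¹ * Real.log ‖y - z‖)) :=
    (contDiff_gaussWeightExp a).mul (contDiff_kerWeight_norm.mul hψ1)
  have hg : ContDiff ℝ 1 fun y => fderiv ℝ w y (EuclideanSpace.single i 1) :=
    (hw.fderiv_right (m := 1) (by norm_num)).clm_apply contDiff_const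
  have hgs : HasCompactSupport fun y => fderiv ℝ w y (EuclideanSpace.single i 1) :=
    hwc.fderiv_apply (𝕜 := ℝ) _
  have hg's : HasCompactSupport fun x => fderiv ℝ (fun y => fderiv ℝ w y (EuclideanSpace.single i 1))
      x (EuclideanSpace.single i 1) := hgs.fderiv_apply (𝕜 := ℝ) _
  have hfc := hf.continuous
  have hf'c : Continuous fun x => fderiv ℝ (fun y : EuclideanSpace ℝ (Fin 2) =>
      Real.exp (a / 4 * ‖y‖ ^ 2) * (kerWeight ‖y‖ * ∫ z, w z * ((2 * π)⁻¹ * Real.log ‖y - z‖))) x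
      (EuclideanSpace.single i 1) := (hf.continuous_fderiv one_ne_zero).clm_apply continuous_const
  have hgc' := hg.continuous
  have hg'c : Continuous fun x => fderiv ℝ (fun y => fderiv ℝ w y (EuclideanSpace.single i 1))
      x (EuclideanSpace.single i 1) := (hg.continuous_fderiv one_ne_zero).clm_apply continuous_const
  have h := integral_mul_fderiv_eq_neg_fderiv_mul_of_integrable (μ := volume)
    (v := EuclideanSpace.single i 1)
    (integrable_mul_of_hasCompactSupport hf'c hgc' hgs)
    (integrable_mul_of_hasCompactSupport hfc hg'c hg's)
    (integrable_mul_of_hasCompactSupport hfc hgc' hgs)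
    (fun x _ => (hf.differentiable one_ne_zero) x) (fun x _ => (hg.differentiable one_ne_zero) x)
  rw [h]
  congr 1
  refine integral_congr_ae (Eventually.of_forall fun x => ?_)
  dsimp only
  rw [fderiv_gaussWeight_mul_correction hw hwc a x i]

/-- **Bound of the correction derivative**: with `Aᵢ = (a/2)xᵢΦψ + (∂ᵢΦ)ψ + Φ∂ᵢψ`,
`|∫ p Aᵢ ∂ᵢw| ≤ √(3((a/2)² + 2) C₁ ∫ p w²) √(∫ p (∂ᵢw)²)`, given the three potential bounds with
constant `C₁`. [folklore] -/
theorem abs_integral_gaussWeight_correctionDeriv_mul_fderiv_le {C₁ : ℝ}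
    (h2 : Integrable (fun x => Real.exp (a / 4 * ‖x‖ ^ 2) * kerWeight ‖x‖ ^ 2 * ‖x‖ ^ 2 * (∫ z, w z * ((2 * π)⁻¹ * Real.log ‖x - z‖)) ^ 2) ∧
      ∫ x, Real.exp (a / 4 * ‖x‖ ^ 2) * kerWeight ‖x‖ ^ 2 * ‖x‖ ^ 2 * (∫ z, w z * ((2 * π)⁻¹ * Real.log ‖x - z‖)) ^ 2 ≤ C₁ * ∫ x, Real.exp (a / 4 * ‖x‖ ^ 2) * w x ^ 2)
    (h3 : Integrable (fun x => Real.exp (a / 4 * ‖x‖ ^ 2) * ‖fderiv ℝ (fun y : EuclideanSpace ℝ (Fin 2) => kerWeight ‖y‖) x‖ ^ 2 * (∫ z, w z * ((2 * π)⁻¹ * Real.log ‖x - z‖)) ^ 2) ∧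
      ∫ x, Real.exp (a / 4 * ‖x‖ ^ 2) * ‖fderiv ℝ (fun y : EuclideanSpace ℝ (Fin 2) => kerWeight ‖y‖) x‖ ^ 2 * (∫ z, w z * ((2 * π)⁻¹ * Real.log ‖x - z‖)) ^ 2 ≤ C₁ * ∫ x, Real.exp (a / 4 * ‖x‖ ^ 2) * w x ^ 2)
    (h4 : Integrable (fun x => Real.exp (a / 4 * ‖x‖ ^ 2) * kerWeight ‖x‖ ^ 2 * ‖biotSavart2D w x‖ ^ 2) ∧
      ∫ x, Real.exp (a / 4 * ‖x‖ ^ 2) * kerWeight ‖x‖ ^ 2 * ‖biotSavart2D w x‖ ^ 2 ≤ C₁ * ∫ x, Real.exp (a / 4 * ‖x‖ ^ 2) * w x ^ 2)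
    (i : Fin 2) :
    |∫ x, Real.exp (a / 4 * ‖x‖ ^ 2) * (a / 2 * x i * kerWeight ‖x‖ * (∫ z, w z * ((2 * π)⁻¹ * Real.log ‖x - z‖)) + fderiv ℝ (fun y : EuclideanSpace ℝ (Fin 2) => kerWeight ‖y‖) x (EuclideanSpace.single i 1) * (∫ z, w z * ((2 * π)⁻¹ * Real.log ‖x - z‖)) + kerWeight ‖x‖ * fderiv ℝ (fun y => ∫ z, w z * ((2 * π)⁻¹ * Real.log ‖y - z‖)) x (EuclideanSpace.single i 1)) * fderiv ℝ w x (EuclideanSpace.single i 1)| ≤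
      Real.sqrt (3 * ((a / 2) ^ 2 + 2) * C₁ * ∫ x, Real.exp (a / 4 * ‖x‖ ^ 2) * w x ^ 2) *
        Real.sqrt (∫ x, Real.exp (a / 4 * ‖x‖ ^ 2) * fderiv ℝ w x (EuclideanSpace.single i 1) ^ 2) := by
  have hw1 : ContDiff ℝ 1 w := hw.of_le one_le_two
  have hψ1 : ContDiff ℝ 1 (fun y => ∫ z, w z * ((2 * π)⁻¹ * Real.log ‖y - z‖)) := contDiff_logPotential (n := 1) hw1 hwc
  have hpc : Continuous fun x : EuclideanSpace ℝ (Fin 2) => Real.exp (a / 4 * ‖x‖ ^ 2) :=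
    (contDiff_gaussWeightExp a (n := 0)).continuous
  have hΦc : Continuous fun x : EuclideanSpace ℝ (Fin 2) => kerWeight ‖x‖ :=
    continuous_kerWeight.comp continuous_norm
  have hΦ'c : Continuous fun x : EuclideanSpace ℝ (Fin 2) => fderiv ℝ (fun y : EuclideanSpace ℝ (Fin 2) => kerWeight ‖y‖) x (EuclideanSpace.single i 1) :=
    (contDiff_kerWeight_norm.continuous_fderiv one_ne_zero).clm_apply continuous_const
  have hψc := hψ1.continuous
  have hψ'c : Continuous fun x : EuclideanSpace ℝ (Fin 2) => fderiv ℝ (fun y => ∫ z, w z * ((2 * π)⁻¹ * Real.log ‖y - z‖)) x (EuclideanSpace.single i 1) :=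
    (hψ1.continuous_fderiv one_ne_zero).clm_apply continuous_const
  have hpi : Continuous fun x : EuclideanSpace ℝ (Fin 2) => x i :=
    (EuclideanSpace.proj (i : Fin 2) : EuclideanSpace ℝ (Fin 2) →L[ℝ] ℝ).continuous
  have hAc : Continuous fun x : EuclideanSpace ℝ (Fin 2) => (a / 2 * x i * kerWeight ‖x‖ * (∫ z, w z * ((2 * π)⁻¹ * Real.log ‖x - z‖)) + fderiv ℝ (fun y : EuclideanSpace ℝ (Fin 2) => kerWeight ‖y‖) x (EuclideanSpace.single i 1) * (∫ z, w z * ((2 * π)⁻¹ * Real.log ‖x - z‖)) + kerWeight ‖x‖ * fderiv ℝ (fun y => ∫ z, w z * ((2 * π)⁻¹ * Real.log ‖y - z‖)) x (EuclideanSpace.single i 1)) := by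
    exact ((((continuous_const.mul hpi).mul hΦc).mul hψc).add (hΦ'c.mul hψc)).add (hΦc.mul hψ'c)
  have hdc : Continuous fun x : EuclideanSpace ℝ (Fin 2) => fderiv ℝ w x (EuclideanSpace.single i 1) :=
    (hw1.continuous_fderiv one_ne_zero).clm_apply continuous_const
  have hds : HasCompactSupport fun x : EuclideanSpace ℝ (Fin 2) => fderiv ℝ w x (EuclideanSpace.single i 1) := hwc.fderiv_apply (𝕜 := ℝ) _
  -- pointwise bounds of the three pieces
  have hN0 : 0 ≤ ∫ x, Real.exp (a / 4 * ‖x‖ ^ 2) * w x ^ 2 := integral_nonneg fun x => by positivity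
  have hxi : ∀ x : EuclideanSpace ℝ (Fin 2), (x i) ^ 2 ≤ ‖x‖ ^ 2 := fun x => by
    have := PiLp.norm_apply_le x i
    rw [Real.norm_eq_abs] at this
    nlinarith [abs_nonneg (x i), sq_abs (x i)]
  have hΦ'le : ∀ x : EuclideanSpace ℝ (Fin 2), (fderiv ℝ (fun y : EuclideanSpace ℝ (Fin 2) => kerWeight ‖y‖) x (EuclideanSpace.single i 1)) ^ 2 ≤ ‖fderiv ℝ (fun y : EuclideanSpace ℝ (Fin 2) => kerWeight ‖y‖) x‖ ^ 2 := fun x => by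
    rw [← sq_abs]
    refine pow_le_pow_left₀ (abs_nonneg _) ?_ 2
    have h := (fderiv ℝ (fun y : EuclideanSpace ℝ (Fin 2) => kerWeight ‖y‖) x).le_opNorm
      (EuclideanSpace.single i 1)
    have hn : ‖EuclideanSpace.single i (1 : ℝ)‖ = 1 := by simp
    rw [hn, mul_one, Real.norm_eq_abs] at h
    exact h
  have hψ'le : ∀ x : EuclideanSpace ℝ (Fin 2), (fderiv ℝ (fun y => ∫ z, w z * ((2 * π)⁻¹ * Real.log ‖y - z‖)) x (EuclideanSpace.single i 1)) ^ 2 ≤ ‖biotSavart2D w x‖ ^ 2 := fun x => by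
    rw [← sq_abs]
    refine pow_le_pow_left₀ (abs_nonneg _) ?_ 2
    rw [fderiv_logPotential_eq hw1 hwc, abs_neg, ← Real.norm_eq_abs]
    calc _ ≤ ‖perp (biotSavart2D w x)‖ * ‖EuclideanSpace.single i (1 : ℝ)‖ := norm_inner_le_norm _ _
      _ = ‖biotSavart2D w x‖ := by rw [norm_perp]; simp
  have hpt : ∀ x : EuclideanSpace ℝ (Fin 2), Real.exp (a / 4 * ‖x‖ ^ 2) * (a / 2 * x i * kerWeight ‖x‖ * (∫ z, w z * ((2 * π)⁻¹ * Real.log ‖x - z‖)) + fderiv ℝ (fun y : EuclideanSpace ℝ (Fin 2) => kerWeight ‖y‖) x (EuclideanSpace.single i 1) * (∫ z, w z * ((2 * π)⁻¹ * Real.log ‖x - z‖)) + kerWeight ‖x‖ * fderiv ℝ (fun y => ∫ z, w z * ((2 * π)⁻¹ * Real.log ‖y - z‖)) x (EuclideanSpace.single i 1)) ^ 2 ≤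
      3 * (a / 2) ^ 2 * (Real.exp (a / 4 * ‖x‖ ^ 2) * kerWeight ‖x‖ ^ 2 * ‖x‖ ^ 2 * (∫ z, w z * ((2 * π)⁻¹ * Real.log ‖x - z‖)) ^ 2) +
      3 * (Real.exp (a / 4 * ‖x‖ ^ 2) * ‖fderiv ℝ (fun y : EuclideanSpace ℝ (Fin 2) => kerWeight ‖y‖) x‖ ^ 2 * (∫ z, w z * ((2 * π)⁻¹ * Real.log ‖x - z‖)) ^ 2) +
      3 * (Real.exp (a / 4 * ‖x‖ ^ 2) * kerWeight ‖x‖ ^ 2 * ‖biotSavart2D w x‖ ^ 2) := by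
    intro x
    have he : 0 < Real.exp (a / 4 * ‖x‖ ^ 2) := Real.exp_pos _
    have hΦ0 : 0 ≤ kerWeight ‖x‖ := (kerWeight_pos _).le
    set t₁ := a / 2 * x i * kerWeight ‖x‖ * (∫ z, w z * ((2 * π)⁻¹ * Real.log ‖x - z‖))
    set t₂ := fderiv ℝ (fun y : EuclideanSpace ℝ (Fin 2) => kerWeight ‖y‖) x (EuclideanSpace.single i 1) * (∫ z, w z * ((2 * π)⁻¹ * Real.log ‖x - z‖))
    set t₃ := kerWeight ‖x‖ * fderiv ℝ (fun y => ∫ z, w z * ((2 * π)⁻¹ * Real.log ‖y - z‖)) x (EuclideanSpace.single i 1)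
    have h3 : (t₁ + t₂ + t₃) ^ 2 ≤ 3 * (t₁ ^ 2 + t₂ ^ 2 + t₃ ^ 2) := by
      nlinarith [sq_nonneg (t₁ - t₂), sq_nonneg (t₁ - t₃), sq_nonneg (t₂ - t₃)]
    have ht₁ : t₁ ^ 2 ≤ (a / 2) ^ 2 * (kerWeight ‖x‖ ^ 2 * ‖x‖ ^ 2 * (∫ z, w z * ((2 * π)⁻¹ * Real.log ‖x - z‖)) ^ 2) := by
      have : t₁ ^ 2 = (a / 2) ^ 2 * (kerWeight ‖x‖ ^ 2 * (x i) ^ 2 * (∫ z, w z * ((2 * π)⁻¹ * Real.log ‖x - z‖)) ^ 2) := by ring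
      rw [this]
      exact mul_le_mul_of_nonneg_left (mul_le_mul_of_nonneg_right (mul_le_mul_of_nonneg_left
        (hxi x) (sq_nonneg _)) (sq_nonneg _)) (sq_nonneg _)
    have ht₂ : t₂ ^ 2 ≤ ‖fderiv ℝ (fun y : EuclideanSpace ℝ (Fin 2) => kerWeight ‖y‖) x‖ ^ 2 * (∫ z, w z * ((2 * π)⁻¹ * Real.log ‖x - z‖)) ^ 2 := by
      have : t₂ ^ 2 = (fderiv ℝ (fun y : EuclideanSpace ℝ (Fin 2) => kerWeight ‖y‖) x (EuclideanSpace.single i 1)) ^ 2 * (∫ z, w z * ((2 * π)⁻¹ * Real.log ‖x - z‖)) ^ 2 := by ring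
      rw [this]; exact mul_le_mul_of_nonneg_right (hΦ'le x) (sq_nonneg _)
    have ht₃ : t₃ ^ 2 ≤ kerWeight ‖x‖ ^ 2 * ‖biotSavart2D w x‖ ^ 2 := by
      have : t₃ ^ 2 = kerWeight ‖x‖ ^ 2 * (fderiv ℝ (fun y => ∫ z, w z * ((2 * π)⁻¹ * Real.log ‖y - z‖)) x (EuclideanSpace.single i 1)) ^ 2 := by ring
      rw [this]; exact mul_le_mul_of_nonneg_left (hψ'le x) (sq_nonneg _)
    calc Real.exp (a / 4 * ‖x‖ ^ 2) * (t₁ + t₂ + t₃) ^ 2 ≤ Real.exp (a / 4 * ‖x‖ ^ 2) * (3 * (t₁ ^ 2 + t₂ ^ 2 + t₃ ^ 2)) :=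
          mul_le_mul_of_nonneg_left h3 he.le
      _ ≤ Real.exp (a / 4 * ‖x‖ ^ 2) * (3 * ((a / 2) ^ 2 * (kerWeight ‖x‖ ^ 2 * ‖x‖ ^ 2 * (∫ z, w z * ((2 * π)⁻¹ * Real.log ‖x - z‖)) ^ 2) +
          ‖fderiv ℝ (fun y : EuclideanSpace ℝ (Fin 2) => kerWeight ‖y‖) x‖ ^ 2 * (∫ z, w z * ((2 * π)⁻¹ * Real.log ‖x - z‖)) ^ 2 + kerWeight ‖x‖ ^ 2 * ‖biotSavart2D w x‖ ^ 2)) := by gcongr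
      _ = _ := by ring
  have hmaj : Integrable fun x => 3 * (a / 2) ^ 2 * (Real.exp (a / 4 * ‖x‖ ^ 2) * kerWeight ‖x‖ ^ 2 * ‖x‖ ^ 2 * (∫ z, w z * ((2 * π)⁻¹ * Real.log ‖x - z‖)) ^ 2) +
      3 * (Real.exp (a / 4 * ‖x‖ ^ 2) * ‖fderiv ℝ (fun y : EuclideanSpace ℝ (Fin 2) => kerWeight ‖y‖) x‖ ^ 2 * (∫ z, w z * ((2 * π)⁻¹ * Real.log ‖x - z‖)) ^ 2) +
      3 * (Real.exp (a / 4 * ‖x‖ ^ 2) * kerWeight ‖x‖ ^ 2 * ‖biotSavart2D w x‖ ^ 2) :=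
    ((h2.1.const_mul _).add (h3.1.const_mul _)).add (h4.1.const_mul _)
  have hiA : Integrable fun x => Real.exp (a / 4 * ‖x‖ ^ 2) * (a / 2 * x i * kerWeight ‖x‖ * (∫ z, w z * ((2 * π)⁻¹ * Real.log ‖x - z‖)) + fderiv ℝ (fun y : EuclideanSpace ℝ (Fin 2) => kerWeight ‖y‖) x (EuclideanSpace.single i 1) * (∫ z, w z * ((2 * π)⁻¹ * Real.log ‖x - z‖)) + kerWeight ‖x‖ * fderiv ℝ (fun y => ∫ z, w z * ((2 * π)⁻¹ * Real.log ‖y - z‖)) x (EuclideanSpace.single i 1)) ^ 2 :=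
    hmaj.mono' (hpc.mul (hAc.pow 2)).aestronglyMeasurable (Eventually.of_forall fun x => by
      rw [Real.norm_of_nonneg (mul_nonneg (Real.exp_pos _).le (sq_nonneg _))]; exact hpt x)
  have hAint : ∫ x, Real.exp (a / 4 * ‖x‖ ^ 2) * (a / 2 * x i * kerWeight ‖x‖ * (∫ z, w z * ((2 * π)⁻¹ * Real.log ‖x - z‖)) + fderiv ℝ (fun y : EuclideanSpace ℝ (Fin 2) => kerWeight ‖y‖) x (EuclideanSpace.single i 1) * (∫ z, w z * ((2 * π)⁻¹ * Real.log ‖x - z‖)) + kerWeight ‖x‖ * fderiv ℝ (fun y => ∫ z, w z * ((2 * π)⁻¹ * Real.log ‖y - z‖)) x (EuclideanSpace.single i 1)) ^ 2 ≤ 3 * ((a / 2) ^ 2 + 2) * C₁ * ∫ x, Real.exp (a / 4 * ‖x‖ ^ 2) * w x ^ 2 := by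
    refine (integral_mono hiA hmaj hpt).trans ?_
    have i12 : Integrable fun x => 3 * (a / 2) ^ 2 * (Real.exp (a / 4 * ‖x‖ ^ 2) * kerWeight ‖x‖ ^ 2 * ‖x‖ ^ 2 * (∫ z, w z * ((2 * π)⁻¹ * Real.log ‖x - z‖)) ^ 2) +
        3 * (Real.exp (a / 4 * ‖x‖ ^ 2) * ‖fderiv ℝ (fun y : EuclideanSpace ℝ (Fin 2) => kerWeight ‖y‖) x‖ ^ 2 * (∫ z, w z * ((2 * π)⁻¹ * Real.log ‖x - z‖)) ^ 2) := (h2.1.const_mul _).add (h3.1.const_mul _)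
    rw [integral_add i12 (h4.1.const_mul _), integral_add (h2.1.const_mul _) (h3.1.const_mul _),
      integral_const_mul, integral_const_mul, integral_const_mul]
    have := h2.2; have := h3.2; have := h4.2
    nlinarith [sq_nonneg a]
  have hiD : Integrable fun x => Real.exp (a / 4 * ‖x‖ ^ 2) * fderiv ℝ w x (EuclideanSpace.single i 1) ^ 2 := by
    have : Integrable fun x => Real.exp (a / 4 * ‖x‖ ^ 2) * fderiv ℝ w x (EuclideanSpace.single i 1) *
        fderiv ℝ w x (EuclideanSpace.single i 1) :=
      integrable_mul_of_hasCompactSupport (hpc.mul hdc) hdc hds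
    exact this.congr (Eventually.of_forall fun x => by beta_reduce; ring)
  have hcs := abs_integral_gaussWeight_mul_mul_le_sqrt (fun x => (Real.exp_pos _).le) hpc.measurable
    hAc.measurable hdc.measurable hiA hiD
  refine hcs.trans (mul_le_mul_of_nonneg_right (Real.sqrt_le_sqrt hAint) (Real.sqrt_nonneg _))

end Correction

/-! ### The uniform energy estimate: the three bounds and the assembly -/

section Energy

variable {lam : ℝ} (hlam0 : 0 ≤ lam) (hlam1 : lam < 1) {w : EuclideanSpace ℝ (Fin 2) → ℝ}
  (hw : ContDiff ℝ 2 w) (hwc : HasCompactSupport w)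
include hlam0 hlam1 hw hwc

/-- **The correction term** `T = ∫ p (Φψ) L_λw`: with `X² = ∫ p|∇w|²`, `N = ∫ p w²` and the
potential bounds with constant `C₁`,
`|T| ≤ 2(√(MN) + √(C₁N)) √X² + √(C₁N) √N`, `M = 3(((1−λ)/2)² + 2)C₁`. [folklore] -/
theorem abs_integral_gaussWeight_correction_mul_strained_le {C₁ : ℝ}
    (h1 : Integrable (fun x => Real.exp ((1 - lam) / 4 * ‖x‖ ^ 2) * kerWeight ‖x‖ ^ 2 * (∫ y, w y * ((2 * π)⁻¹ * Real.log ‖x - y‖)) ^ 2) ∧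
      ∫ x, Real.exp ((1 - lam) / 4 * ‖x‖ ^ 2) * kerWeight ‖x‖ ^ 2 * (∫ y, w y * ((2 * π)⁻¹ * Real.log ‖x - y‖)) ^ 2 ≤ C₁ * ∫ x, Real.exp ((1 - lam) / 4 * ‖x‖ ^ 2) * w x ^ 2)
    (h2 : Integrable (fun x => Real.exp ((1 - lam) / 4 * ‖x‖ ^ 2) * kerWeight ‖x‖ ^ 2 * ‖x‖ ^ 2 * (∫ y, w y * ((2 * π)⁻¹ * Real.log ‖x - y‖)) ^ 2) ∧
      ∫ x, Real.exp ((1 - lam) / 4 * ‖x‖ ^ 2) * kerWeight ‖x‖ ^ 2 * ‖x‖ ^ 2 * (∫ y, w y * ((2 * π)⁻¹ * Real.log ‖x - y‖)) ^ 2 ≤ C₁ * ∫ x, Real.exp ((1 - lam) / 4 * ‖x‖ ^ 2) * w x ^ 2)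
    (h3 : Integrable (fun x => Real.exp ((1 - lam) / 4 * ‖x‖ ^ 2) * ‖fderiv ℝ (fun y : EuclideanSpace ℝ (Fin 2) => kerWeight ‖y‖) x‖ ^ 2 * (∫ y, w y * ((2 * π)⁻¹ * Real.log ‖x - y‖)) ^ 2) ∧
      ∫ x, Real.exp ((1 - lam) / 4 * ‖x‖ ^ 2) * ‖fderiv ℝ (fun y : EuclideanSpace ℝ (Fin 2) => kerWeight ‖y‖) x‖ ^ 2 * (∫ y, w y * ((2 * π)⁻¹ * Real.log ‖x - y‖)) ^ 2 ≤ C₁ * ∫ x, Real.exp ((1 - lam) / 4 * ‖x‖ ^ 2) * w x ^ 2)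
    (h4 : Integrable (fun x => Real.exp ((1 - lam) / 4 * ‖x‖ ^ 2) * kerWeight ‖x‖ ^ 2 * ‖biotSavart2D w x‖ ^ 2) ∧
      ∫ x, Real.exp ((1 - lam) / 4 * ‖x‖ ^ 2) * kerWeight ‖x‖ ^ 2 * ‖biotSavart2D w x‖ ^ 2 ≤ C₁ * ∫ x, Real.exp ((1 - lam) / 4 * ‖x‖ ^ 2) * w x ^ 2) :
    |∫ x, Real.exp ((1 - lam) / 4 * ‖x‖ ^ 2) * (kerWeight ‖x‖ * ∫ y, w y * ((2 * π)⁻¹ * Real.log ‖x - y‖)) * strainedVorticityOperator lam w x| ≤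
      2 * (Real.sqrt (3 * (((1 - lam) / 2) ^ 2 + 2) * C₁ * ∫ x, Real.exp ((1 - lam) / 4 * ‖x‖ ^ 2) * w x ^ 2) + Real.sqrt (C₁ * ∫ x, Real.exp ((1 - lam) / 4 * ‖x‖ ^ 2) * w x ^ 2)) *
        Real.sqrt (∫ x, Real.exp ((1 - lam) / 4 * ‖x‖ ^ 2) * (fderiv ℝ w x (EuclideanSpace.single 0 1) ^ 2 + fderiv ℝ w x (EuclideanSpace.single 1 1) ^ 2)) + Real.sqrt (C₁ * ∫ x, Real.exp ((1 - lam) / 4 * ‖x‖ ^ 2) * w x ^ 2) * Real.sqrt (∫ x, Real.exp ((1 - lam) / 4 * ‖x‖ ^ 2) * w x ^ 2) := by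
  have ha0 : 0 < 1 - lam := by linarith
  have hw1 : ContDiff ℝ 1 w := hw.of_le one_le_two
  have hpc : Continuous fun x : EuclideanSpace ℝ (Fin 2) => Real.exp ((1 - lam) / 4 * ‖x‖ ^ 2) := (contDiff_gaussWeightExp (1 - lam) (n := 0)).continuous
  have hΦc : Continuous fun x : EuclideanSpace ℝ (Fin 2) => kerWeight ‖x‖ := continuous_kerWeight.comp continuous_norm
  have hψ1 : ContDiff ℝ 1 (fun y => ∫ z, w z * ((2 * π)⁻¹ * Real.log ‖y - z‖)) := contDiff_logPotential (n := 1) hw1 hwc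
  have hψc : Continuous fun x : EuclideanSpace ℝ (Fin 2) => (∫ y, w y * ((2 * π)⁻¹ * Real.log ‖x - y‖)) := hψ1.continuous
  have hdc : ∀ i : Fin 2, Continuous fun x : EuclideanSpace ℝ (Fin 2) => fderiv ℝ w x (EuclideanSpace.single i 1) :=
    fun i => (hw1.continuous_fderiv one_ne_zero).clm_apply continuous_const
  have hds : ∀ i : Fin 2, HasCompactSupport fun x : EuclideanSpace ℝ (Fin 2) => fderiv ℝ w x (EuclideanSpace.single i 1) :=
    fun i => hwc.fderiv_apply (𝕜 := ℝ) _
  have hpi : ∀ j : Fin 2, Continuous fun x : EuclideanSpace ℝ (Fin 2) => x j := fun j =>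
    (EuclideanSpace.proj (j : Fin 2) : EuclideanSpace ℝ (Fin 2) →L[ℝ] ℝ).continuous
  have hws : HasCompactSupport fun x : EuclideanSpace ℝ (Fin 2) => w x ^ 2 := hwc.comp_left (g := fun t : ℝ => t ^ 2) (by simp)
  have iNw : Integrable fun x : EuclideanSpace ℝ (Fin 2) => Real.exp ((1 - lam) / 4 * ‖x‖ ^ 2) * w x ^ 2 :=
    (integral_exp_eighth_mul_sq_le ha0.le hw.continuous hwc).1
  have iX : ∀ i : Fin 2, Integrable fun x : EuclideanSpace ℝ (Fin 2) => Real.exp ((1 - lam) / 4 * ‖x‖ ^ 2) * fderiv ℝ w x (EuclideanSpace.single i 1) ^ 2 := by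
    intro i
    have : Integrable fun x : EuclideanSpace ℝ (Fin 2) => Real.exp ((1 - lam) / 4 * ‖x‖ ^ 2) * fderiv ℝ w x (EuclideanSpace.single i 1) *
        fderiv ℝ w x (EuclideanSpace.single i 1) :=
      integrable_mul_of_hasCompactSupport (hpc.mul (hdc i)) (hdc i) (hds i)
    exact this.congr (Eventually.of_forall fun x => by beta_reduce; ring)
  have hN0 : 0 ≤ ∫ x, Real.exp ((1 - lam) / 4 * ‖x‖ ^ 2) * w x ^ 2 := integral_nonneg fun x => by positivity
  have hX0 : ∀ i : Fin 2, 0 ≤ ∫ x, Real.exp ((1 - lam) / 4 * ‖x‖ ^ 2) * fderiv ℝ w x (EuclideanSpace.single i 1) ^ 2 :=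
    fun i => integral_nonneg fun x => by positivity
  have hX2eq : ∫ x, Real.exp ((1 - lam) / 4 * ‖x‖ ^ 2) * (fderiv ℝ w x (EuclideanSpace.single 0 1) ^ 2 + fderiv ℝ w x (EuclideanSpace.single 1 1) ^ 2) = (∫ x, Real.exp ((1 - lam) / 4 * ‖x‖ ^ 2) * fderiv ℝ w x (EuclideanSpace.single 0 1) ^ 2) + ∫ x, Real.exp ((1 - lam) / 4 * ‖x‖ ^ 2) * fderiv ℝ w x (EuclideanSpace.single 1 1) ^ 2 := by
    rw [← integral_add (iX 0) (iX 1)]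
    exact integral_congr_ae (Eventually.of_forall fun x => by beta_reduce; ring)
  have hddc : ∀ i : Fin 2, Continuous fun x : EuclideanSpace ℝ (Fin 2) =>
      fderiv ℝ (fun y => fderiv ℝ w y (EuclideanSpace.single i 1)) x (EuclideanSpace.single i 1) :=
    fun i => continuous_fderiv_fderiv_of_contDiff_two hw _ _
  have hdds : ∀ i : Fin 2, HasCompactSupport fun x : EuclideanSpace ℝ (Fin 2) =>
      fderiv ℝ (fun y => fderiv ℝ w y (EuclideanSpace.single i 1)) x (EuclideanSpace.single i 1) :=
    fun i => (hwc.fderiv_apply (𝕜 := ℝ) _).fderiv_apply (𝕜 := ℝ) _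
  have hΔ : ∀ x : EuclideanSpace ℝ (Fin 2), strainedVorticityOperator lam w x = fderiv ℝ (fun y => fderiv ℝ w y (EuclideanSpace.single 0 1)) x (EuclideanSpace.single 0 1) + fderiv ℝ (fun y => fderiv ℝ w y (EuclideanSpace.single 1 1)) x (EuclideanSpace.single 1 1) + (1 + lam) / 2 * x 0 * fderiv ℝ w x (EuclideanSpace.single 0 1) +
      (1 - lam) / 2 * x 1 * fderiv ℝ w x (EuclideanSpace.single 1 1) + w x := fun x => by
    simp only [strainedVorticityOperator, laplacian_eq_fin_two_of_contDiff_two' hw]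
  have hΦψc : Continuous fun x : EuclideanSpace ℝ (Fin 2) => (kerWeight ‖x‖ * ∫ y, w y * ((2 * π)⁻¹ * Real.log ‖x - y‖)) := hΦc.mul hψc
  have j1 : ∀ i : Fin 2, Integrable fun x : EuclideanSpace ℝ (Fin 2) => Real.exp ((1 - lam) / 4 * ‖x‖ ^ 2) * (kerWeight ‖x‖ * ∫ y, w y * ((2 * π)⁻¹ * Real.log ‖x - y‖)) *
      fderiv ℝ (fun y => fderiv ℝ w y (EuclideanSpace.single i 1)) x (EuclideanSpace.single i 1) :=
    fun i => integrable_mul_of_hasCompactSupport (hpc.mul hΦψc) (hddc i) (hdds i)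
  have j2 : ∀ i : Fin 2, Integrable fun x : EuclideanSpace ℝ (Fin 2) => Real.exp ((1 - lam) / 4 * ‖x‖ ^ 2) * (x i * kerWeight ‖x‖ * (∫ y, w y * ((2 * π)⁻¹ * Real.log ‖x - y‖))) *
      fderiv ℝ w x (EuclideanSpace.single i 1) :=
    fun i => integrable_mul_of_hasCompactSupport (hpc.mul (((hpi i).mul hΦc).mul hψc)) (hdc i) (hds i)
  have j3 : Integrable fun x : EuclideanSpace ℝ (Fin 2) => Real.exp ((1 - lam) / 4 * ‖x‖ ^ 2) * (kerWeight ‖x‖ * ∫ y, w y * ((2 * π)⁻¹ * Real.log ‖x - y‖)) * w x :=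
    integrable_mul_of_hasCompactSupport (hpc.mul hΦψc) hw.continuous hwc
  -- split `T` into five integrals
  have hcongr : ∫ x, Real.exp ((1 - lam) / 4 * ‖x‖ ^ 2) * (kerWeight ‖x‖ * ∫ y, w y * ((2 * π)⁻¹ * Real.log ‖x - y‖)) * strainedVorticityOperator lam w x = ∫ x, Real.exp ((1 - lam) / 4 * ‖x‖ ^ 2) * (kerWeight ‖x‖ * ∫ y, w y * ((2 * π)⁻¹ * Real.log ‖x - y‖)) * fderiv ℝ (fun y => fderiv ℝ w y (EuclideanSpace.single 0 1)) x (EuclideanSpace.single 0 1) + Real.exp ((1 - lam) / 4 * ‖x‖ ^ 2) * (kerWeight ‖x‖ * ∫ y, w y * ((2 * π)⁻¹ * Real.log ‖x - y‖)) * fderiv ℝ (fun y => fderiv ℝ w y (EuclideanSpace.single 1 1)) x (EuclideanSpace.single 1 1) +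
      (1 + lam) / 2 * (Real.exp ((1 - lam) / 4 * ‖x‖ ^ 2) * (x 0 * kerWeight ‖x‖ * (∫ y, w y * ((2 * π)⁻¹ * Real.log ‖x - y‖))) * fderiv ℝ w x (EuclideanSpace.single 0 1)) +
      (1 - lam) / 2 * (Real.exp ((1 - lam) / 4 * ‖x‖ ^ 2) * (x 1 * kerWeight ‖x‖ * (∫ y, w y * ((2 * π)⁻¹ * Real.log ‖x - y‖))) * fderiv ℝ w x (EuclideanSpace.single 1 1)) + Real.exp ((1 - lam) / 4 * ‖x‖ ^ 2) * (kerWeight ‖x‖ * ∫ y, w y * ((2 * π)⁻¹ * Real.log ‖x - y‖)) * w x :=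
    integral_congr_ae (Eventually.of_forall fun x => by simp only [hΔ x]; ring)
  have k3 : Integrable fun x : EuclideanSpace ℝ (Fin 2) => (1 + lam) / 2 * (Real.exp ((1 - lam) / 4 * ‖x‖ ^ 2) * (x 0 * kerWeight ‖x‖ * (∫ y, w y * ((2 * π)⁻¹ * Real.log ‖x - y‖))) * fderiv ℝ w x (EuclideanSpace.single 0 1)) :=
    (j2 0).const_mul _
  have k4 : Integrable fun x : EuclideanSpace ℝ (Fin 2) => (1 - lam) / 2 * (Real.exp ((1 - lam) / 4 * ‖x‖ ^ 2) * (x 1 * kerWeight ‖x‖ * (∫ y, w y * ((2 * π)⁻¹ * Real.log ‖x - y‖))) * fderiv ℝ w x (EuclideanSpace.single 1 1)) :=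
    (j2 1).const_mul _
  have hF2 : Integrable fun x : EuclideanSpace ℝ (Fin 2) => Real.exp ((1 - lam) / 4 * ‖x‖ ^ 2) * (kerWeight ‖x‖ * ∫ y, w y * ((2 * π)⁻¹ * Real.log ‖x - y‖)) * fderiv ℝ (fun y => fderiv ℝ w y (EuclideanSpace.single 0 1)) x (EuclideanSpace.single 0 1) + Real.exp ((1 - lam) / 4 * ‖x‖ ^ 2) * (kerWeight ‖x‖ * ∫ y, w y * ((2 * π)⁻¹ * Real.log ‖x - y‖)) * fderiv ℝ (fun y => fderiv ℝ w y (EuclideanSpace.single 1 1)) x (EuclideanSpace.single 1 1) := (j1 0).add (j1 1)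
  have hF3 : Integrable fun x : EuclideanSpace ℝ (Fin 2) => Real.exp ((1 - lam) / 4 * ‖x‖ ^ 2) * (kerWeight ‖x‖ * ∫ y, w y * ((2 * π)⁻¹ * Real.log ‖x - y‖)) * fderiv ℝ (fun y => fderiv ℝ w y (EuclideanSpace.single 0 1)) x (EuclideanSpace.single 0 1) + Real.exp ((1 - lam) / 4 * ‖x‖ ^ 2) * (kerWeight ‖x‖ * ∫ y, w y * ((2 * π)⁻¹ * Real.log ‖x - y‖)) * fderiv ℝ (fun y => fderiv ℝ w y (EuclideanSpace.single 1 1)) x (EuclideanSpace.single 1 1) +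
      (1 + lam) / 2 * (Real.exp ((1 - lam) / 4 * ‖x‖ ^ 2) * (x 0 * kerWeight ‖x‖ * (∫ y, w y * ((2 * π)⁻¹ * Real.log ‖x - y‖))) * fderiv ℝ w x (EuclideanSpace.single 0 1)) := hF2.add k3
  have hF4 : Integrable fun x : EuclideanSpace ℝ (Fin 2) => Real.exp ((1 - lam) / 4 * ‖x‖ ^ 2) * (kerWeight ‖x‖ * ∫ y, w y * ((2 * π)⁻¹ * Real.log ‖x - y‖)) * fderiv ℝ (fun y => fderiv ℝ w y (EuclideanSpace.single 0 1)) x (EuclideanSpace.single 0 1) + Real.exp ((1 - lam) / 4 * ‖x‖ ^ 2) * (kerWeight ‖x‖ * ∫ y, w y * ((2 * π)⁻¹ * Real.log ‖x - y‖)) * fderiv ℝ (fun y => fderiv ℝ w y (EuclideanSpace.single 1 1)) x (EuclideanSpace.single 1 1) +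
      (1 + lam) / 2 * (Real.exp ((1 - lam) / 4 * ‖x‖ ^ 2) * (x 0 * kerWeight ‖x‖ * (∫ y, w y * ((2 * π)⁻¹ * Real.log ‖x - y‖))) * fderiv ℝ w x (EuclideanSpace.single 0 1)) +
      (1 - lam) / 2 * (Real.exp ((1 - lam) / 4 * ‖x‖ ^ 2) * (x 1 * kerWeight ‖x‖ * (∫ y, w y * ((2 * π)⁻¹ * Real.log ‖x - y‖))) * fderiv ℝ w x (EuclideanSpace.single 1 1)) := hF3.add k4
  have hTsplit : ∫ x, Real.exp ((1 - lam) / 4 * ‖x‖ ^ 2) * (kerWeight ‖x‖ * ∫ y, w y * ((2 * π)⁻¹ * Real.log ‖x - y‖)) * strainedVorticityOperator lam w x =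
      (∫ x, Real.exp ((1 - lam) / 4 * ‖x‖ ^ 2) * (kerWeight ‖x‖ * ∫ y, w y * ((2 * π)⁻¹ * Real.log ‖x - y‖)) * fderiv ℝ (fun y => fderiv ℝ w y (EuclideanSpace.single 0 1)) x (EuclideanSpace.single 0 1)) + (∫ x, Real.exp ((1 - lam) / 4 * ‖x‖ ^ 2) * (kerWeight ‖x‖ * ∫ y, w y * ((2 * π)⁻¹ * Real.log ‖x - y‖)) * fderiv ℝ (fun y => fderiv ℝ w y (EuclideanSpace.single 1 1)) x (EuclideanSpace.single 1 1)) +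
      (1 + lam) / 2 * (∫ x, Real.exp ((1 - lam) / 4 * ‖x‖ ^ 2) * (x 0 * kerWeight ‖x‖ * (∫ y, w y * ((2 * π)⁻¹ * Real.log ‖x - y‖))) * fderiv ℝ w x (EuclideanSpace.single 0 1)) +
      (1 - lam) / 2 * (∫ x, Real.exp ((1 - lam) / 4 * ‖x‖ ^ 2) * (x 1 * kerWeight ‖x‖ * (∫ y, w y * ((2 * π)⁻¹ * Real.log ‖x - y‖))) * fderiv ℝ w x (EuclideanSpace.single 1 1)) +
      ∫ x, Real.exp ((1 - lam) / 4 * ‖x‖ ^ 2) * (kerWeight ‖x‖ * ∫ y, w y * ((2 * π)⁻¹ * Real.log ‖x - y‖)) * w x := by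
    rw [hcongr, integral_add hF4 j3, integral_add hF3 k4, integral_add hF2 k3, integral_add (j1 0) (j1 1),
      integral_const_mul, integral_const_mul]
  -- `T1ᵢ`
  have hT1 : ∀ i : Fin 2, |∫ x, Real.exp ((1 - lam) / 4 * ‖x‖ ^ 2) * (kerWeight ‖x‖ * ∫ y, w y * ((2 * π)⁻¹ * Real.log ‖x - y‖)) *
      fderiv ℝ (fun y => fderiv ℝ w y (EuclideanSpace.single i 1)) x (EuclideanSpace.single i 1)| ≤
      Real.sqrt (3 * (((1 - lam) / 2) ^ 2 + 2) * C₁ * ∫ x, Real.exp ((1 - lam) / 4 * ‖x‖ ^ 2) * w x ^ 2) *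
        Real.sqrt (∫ x, Real.exp ((1 - lam) / 4 * ‖x‖ ^ 2) * fderiv ℝ w x (EuclideanSpace.single i 1) ^ 2) := by
    intro i
    rw [integral_gaussWeight_correction_mul_fderiv_fderiv hw hwc (1 - lam) i, abs_neg]
    exact abs_integral_gaussWeight_correctionDeriv_mul_fderiv_le hw hwc (1 - lam) h2 h3 h4 i
  -- `T2ᵢ`
  have hT2 : ∀ i : Fin 2, |∫ x, Real.exp ((1 - lam) / 4 * ‖x‖ ^ 2) * (x i * kerWeight ‖x‖ * (∫ y, w y * ((2 * π)⁻¹ * Real.log ‖x - y‖))) * fderiv ℝ w x (EuclideanSpace.single i 1)| ≤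
      Real.sqrt (C₁ * ∫ x, Real.exp ((1 - lam) / 4 * ‖x‖ ^ 2) * w x ^ 2) * Real.sqrt (∫ x, Real.exp ((1 - lam) / 4 * ‖x‖ ^ 2) * fderiv ℝ w x (EuclideanSpace.single i 1) ^ 2) := by
    intro i
    have hxi : ∀ x : EuclideanSpace ℝ (Fin 2), (x i) ^ 2 ≤ ‖x‖ ^ 2 := fun x => by
      have := PiLp.norm_apply_le x i
      rw [Real.norm_eq_abs] at this
      nlinarith [abs_nonneg (x i), sq_abs (x i)]
    have hpt : ∀ x : EuclideanSpace ℝ (Fin 2), Real.exp ((1 - lam) / 4 * ‖x‖ ^ 2) * (x i * kerWeight ‖x‖ * (∫ y, w y * ((2 * π)⁻¹ * Real.log ‖x - y‖))) ^ 2 ≤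
        Real.exp ((1 - lam) / 4 * ‖x‖ ^ 2) * kerWeight ‖x‖ ^ 2 * ‖x‖ ^ 2 * (∫ y, w y * ((2 * π)⁻¹ * Real.log ‖x - y‖)) ^ 2 := fun x => by
      have : Real.exp ((1 - lam) / 4 * ‖x‖ ^ 2) * (x i * kerWeight ‖x‖ * (∫ y, w y * ((2 * π)⁻¹ * Real.log ‖x - y‖))) ^ 2 =
          Real.exp ((1 - lam) / 4 * ‖x‖ ^ 2) * kerWeight ‖x‖ ^ 2 * (x i) ^ 2 * (∫ y, w y * ((2 * π)⁻¹ * Real.log ‖x - y‖)) ^ 2 := by ring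
      rw [this]
      exact mul_le_mul_of_nonneg_right (mul_le_mul_of_nonneg_left (hxi x) (by positivity)) (sq_nonneg _)
    have iA : Integrable fun x : EuclideanSpace ℝ (Fin 2) => Real.exp ((1 - lam) / 4 * ‖x‖ ^ 2) * (x i * kerWeight ‖x‖ * (∫ y, w y * ((2 * π)⁻¹ * Real.log ‖x - y‖))) ^ 2 :=
      h2.1.mono' (hpc.mul ((((hpi i).mul hΦc).mul hψc).pow 2)).aestronglyMeasurable
        (Eventually.of_forall fun x => by
          rw [Real.norm_of_nonneg (mul_nonneg (Real.exp_pos _).le (sq_nonneg _))]; exact hpt x)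
    have hA : ∫ x, Real.exp ((1 - lam) / 4 * ‖x‖ ^ 2) * (x i * kerWeight ‖x‖ * (∫ y, w y * ((2 * π)⁻¹ * Real.log ‖x - y‖))) ^ 2 ≤ C₁ * ∫ x, Real.exp ((1 - lam) / 4 * ‖x‖ ^ 2) * w x ^ 2 := (integral_mono iA h2.1 hpt).trans h2.2
    have h := abs_integral_gaussWeight_mul_mul_le_sqrt (fun x => (Real.exp_pos _).le) hpc.measurable
      (((hpi i).mul hΦc).mul hψc).measurable (hdc i).measurable iA (iX i)
    exact h.trans (mul_le_mul_of_nonneg_right (Real.sqrt_le_sqrt hA) (Real.sqrt_nonneg _))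
  -- `T3`
  have hT3 : |∫ x, Real.exp ((1 - lam) / 4 * ‖x‖ ^ 2) * (kerWeight ‖x‖ * ∫ y, w y * ((2 * π)⁻¹ * Real.log ‖x - y‖)) * w x| ≤ Real.sqrt (C₁ * ∫ x, Real.exp ((1 - lam) / 4 * ‖x‖ ^ 2) * w x ^ 2) * Real.sqrt (∫ x, Real.exp ((1 - lam) / 4 * ‖x‖ ^ 2) * w x ^ 2) := by
    have iA : Integrable fun x : EuclideanSpace ℝ (Fin 2) => Real.exp ((1 - lam) / 4 * ‖x‖ ^ 2) * (kerWeight ‖x‖ * ∫ y, w y * ((2 * π)⁻¹ * Real.log ‖x - y‖)) ^ 2 :=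
      h1.1.congr (Eventually.of_forall fun x => by beta_reduce; ring)
    have hA : ∫ x, Real.exp ((1 - lam) / 4 * ‖x‖ ^ 2) * (kerWeight ‖x‖ * ∫ y, w y * ((2 * π)⁻¹ * Real.log ‖x - y‖)) ^ 2 ≤ C₁ * ∫ x, Real.exp ((1 - lam) / 4 * ‖x‖ ^ 2) * w x ^ 2 := by
      calc ∫ x, Real.exp ((1 - lam) / 4 * ‖x‖ ^ 2) * (kerWeight ‖x‖ * ∫ y, w y * ((2 * π)⁻¹ * Real.log ‖x - y‖)) ^ 2 = ∫ x, Real.exp ((1 - lam) / 4 * ‖x‖ ^ 2) * kerWeight ‖x‖ ^ 2 * (∫ y, w y * ((2 * π)⁻¹ * Real.log ‖x - y‖)) ^ 2 :=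
            integral_congr_ae (Eventually.of_forall fun x => by beta_reduce; ring)
        _ ≤ _ := h1.2
    have h := abs_integral_gaussWeight_mul_mul_le_sqrt (fun x => (Real.exp_pos _).le) hpc.measurable
      hΦψc.measurable hw.continuous.measurable iA iNw
    exact h.trans (mul_le_mul_of_nonneg_right (Real.sqrt_le_sqrt hA) (Real.sqrt_nonneg _))
  -- `√Xᵢ ≤ √X²` and assembly
  have hXi : ∀ i : Fin 2, Real.sqrt (∫ x, Real.exp ((1 - lam) / 4 * ‖x‖ ^ 2) * fderiv ℝ w x (EuclideanSpace.single i 1) ^ 2) ≤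
      Real.sqrt (∫ x, Real.exp ((1 - lam) / 4 * ‖x‖ ^ 2) * (fderiv ℝ w x (EuclideanSpace.single 0 1) ^ 2 + fderiv ℝ w x (EuclideanSpace.single 1 1) ^ 2)) := by
    intro i
    refine Real.sqrt_le_sqrt ?_
    rw [hX2eq]
    fin_cases i
    · simpa using hX0 1
    · simpa using hX0 0
  rw [hTsplit]
  have hlam1' : (1 + lam) / 2 ≤ 1 := by linarith
  have hlam2' : (1 - lam) / 2 ≤ 1 := by linarith
  have hlam3 : 0 ≤ (1 + lam) / 2 := by linarith
  have hlam4 : 0 ≤ (1 - lam) / 2 := by linarith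
  set sM := Real.sqrt (3 * (((1 - lam) / 2) ^ 2 + 2) * C₁ * ∫ x, Real.exp ((1 - lam) / 4 * ‖x‖ ^ 2) * w x ^ 2) with hsM
  set sC := Real.sqrt (C₁ * ∫ x, Real.exp ((1 - lam) / 4 * ‖x‖ ^ 2) * w x ^ 2) with hsC
  set sX := Real.sqrt (∫ x, Real.exp ((1 - lam) / 4 * ‖x‖ ^ 2) * (fderiv ℝ w x (EuclideanSpace.single 0 1) ^ 2 + fderiv ℝ w x (EuclideanSpace.single 1 1) ^ 2)) with hsX
  have hsM0 : 0 ≤ sM := Real.sqrt_nonneg _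
  have hsC0 : 0 ≤ sC := Real.sqrt_nonneg _
  have a1 := (hT1 0).trans (mul_le_mul_of_nonneg_left (hXi 0) hsM0)
  have a2 := (hT1 1).trans (mul_le_mul_of_nonneg_left (hXi 1) hsM0)
  have a3 := (hT2 0).trans (mul_le_mul_of_nonneg_left (hXi 0) hsC0)
  have a4 := (hT2 1).trans (mul_le_mul_of_nonneg_left (hXi 1) hsC0)
  have hsX0 : 0 ≤ sX := Real.sqrt_nonneg _
  have b3 : |(1 + lam) / 2 * ∫ x, Real.exp ((1 - lam) / 4 * ‖x‖ ^ 2) * (x 0 * kerWeight ‖x‖ * (∫ y, w y * ((2 * π)⁻¹ * Real.log ‖x - y‖))) * fderiv ℝ w x (EuclideanSpace.single 0 1)| ≤ sC * sX := by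
    rw [abs_mul, abs_of_nonneg hlam3]
    exact (mul_le_mul hlam1' a3 (abs_nonneg _) zero_le_one).trans (by rw [one_mul])
  have b4 : |(1 - lam) / 2 * ∫ x, Real.exp ((1 - lam) / 4 * ‖x‖ ^ 2) * (x 1 * kerWeight ‖x‖ * (∫ y, w y * ((2 * π)⁻¹ * Real.log ‖x - y‖))) * fderiv ℝ w x (EuclideanSpace.single 1 1)| ≤ sC * sX := by
    rw [abs_mul, abs_of_nonneg hlam4]
    exact (mul_le_mul hlam2' a4 (abs_nonneg _) zero_le_one).trans (by rw [one_mul])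
  have key : ∀ a b c d e : ℝ, |a + b + c + d + e| ≤ |a| + |b| + |c| + |d| + |e| := by
    intro a b c d e
    have h1 := abs_add_le (a + b + c + d) e
    have h2 := abs_add_le (a + b + c) d
    have h3 := abs_add_le (a + b) c
    have h4 := abs_add_le a b
    linarith
  refine (key _ _ _ _ _).trans ?_
  linarith [a1, a2, b3, b4, hT3]

omit hlam0 in
/-- **The ground-state bound**: `((1−λ)²/16) ∫ p|x|²w² ≤ ∫ p|∇w|² − ((1−λ)/2) ∫ p w²`, from
`0 ≤ ∫ p (∂ᵢw + ((1−λ)/4) xᵢ w)²` and `∫ p w xᵢ∂ᵢw = −½∫(p + xᵢ∂ᵢp) w²`. [folklore] -/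
theorem gaussWeight_ground_state_bound :
    (1 - lam) ^ 2 / 16 * ∫ x, Real.exp ((1 - lam) / 4 * ‖x‖ ^ 2) * (‖x‖ ^ 2 * w x ^ 2) ≤ (∫ x, Real.exp ((1 - lam) / 4 * ‖x‖ ^ 2) * (fderiv ℝ w x (EuclideanSpace.single 0 1) ^ 2 + fderiv ℝ w x (EuclideanSpace.single 1 1) ^ 2)) - (1 - lam) / 2 * ∫ x, Real.exp ((1 - lam) / 4 * ‖x‖ ^ 2) * w x ^ 2 := by
  have ha0 : 0 < 1 - lam := by linarith
  have hw1 : ContDiff ℝ 1 w := hw.of_le one_le_two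
  have hpc : Continuous fun x : EuclideanSpace ℝ (Fin 2) => Real.exp ((1 - lam) / 4 * ‖x‖ ^ 2) := (contDiff_gaussWeightExp (1 - lam) (n := 0)).continuous
  have hdc : ∀ i : Fin 2, Continuous fun x : EuclideanSpace ℝ (Fin 2) => fderiv ℝ w x (EuclideanSpace.single i 1) :=
    fun i => (hw1.continuous_fderiv one_ne_zero).clm_apply continuous_const
  have hds : ∀ i : Fin 2, HasCompactSupport fun x : EuclideanSpace ℝ (Fin 2) => fderiv ℝ w x (EuclideanSpace.single i 1) :=
    fun i => hwc.fderiv_apply (𝕜 := ℝ) _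
  have hpi : ∀ j : Fin 2, Continuous fun x : EuclideanSpace ℝ (Fin 2) => x j := fun j =>
    (EuclideanSpace.proj (j : Fin 2) : EuclideanSpace ℝ (Fin 2) →L[ℝ] ℝ).continuous
  have hws : HasCompactSupport fun x : EuclideanSpace ℝ (Fin 2) => w x ^ 2 := hwc.comp_left (g := fun t : ℝ => t ^ 2) (by simp)
  have iNw : Integrable fun x : EuclideanSpace ℝ (Fin 2) => Real.exp ((1 - lam) / 4 * ‖x‖ ^ 2) * w x ^ 2 :=
    (integral_exp_eighth_mul_sq_le ha0.le hw.continuous hwc).1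
  have iX : ∀ i : Fin 2, Integrable fun x : EuclideanSpace ℝ (Fin 2) => Real.exp ((1 - lam) / 4 * ‖x‖ ^ 2) * fderiv ℝ w x (EuclideanSpace.single i 1) ^ 2 := by
    intro i
    have : Integrable fun x : EuclideanSpace ℝ (Fin 2) => Real.exp ((1 - lam) / 4 * ‖x‖ ^ 2) * fderiv ℝ w x (EuclideanSpace.single i 1) *
        fderiv ℝ w x (EuclideanSpace.single i 1) :=
      integrable_mul_of_hasCompactSupport (hpc.mul (hdc i)) (hdc i) (hds i)
    exact this.congr (Eventually.of_forall fun x => by beta_reduce; ring)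
  have hX2eq : ∫ x, Real.exp ((1 - lam) / 4 * ‖x‖ ^ 2) * (fderiv ℝ w x (EuclideanSpace.single 0 1) ^ 2 + fderiv ℝ w x (EuclideanSpace.single 1 1) ^ 2) = (∫ x, Real.exp ((1 - lam) / 4 * ‖x‖ ^ 2) * fderiv ℝ w x (EuclideanSpace.single 0 1) ^ 2) + ∫ x, Real.exp ((1 - lam) / 4 * ‖x‖ ^ 2) * fderiv ℝ w x (EuclideanSpace.single 1 1) ^ 2 := by
    rw [← integral_add (iX 0) (iX 1)]
    exact integral_congr_ae (Eventually.of_forall fun x => by beta_reduce; ring)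
  have jI : ∀ i : Fin 2, Integrable fun x : EuclideanSpace ℝ (Fin 2) => Real.exp ((1 - lam) / 4 * ‖x‖ ^ 2) * w x * (x i * fderiv ℝ w x (EuclideanSpace.single i 1)) := by
    intro i
    have : Integrable fun x : EuclideanSpace ℝ (Fin 2) => Real.exp ((1 - lam) / 4 * ‖x‖ ^ 2) * w x * x i * fderiv ℝ w x (EuclideanSpace.single i 1) :=
      integrable_mul_of_hasCompactSupport ((hpc.mul hw.continuous).mul (hpi i)) (hdc i) (hds i)
    exact this.congr (Eventually.of_forall fun x => by beta_reduce; ring)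
  have jM : ∀ i : Fin 2, Integrable fun x : EuclideanSpace ℝ (Fin 2) => Real.exp ((1 - lam) / 4 * ‖x‖ ^ 2) * (x i ^ 2 * w x ^ 2) := by
    intro i
    have : Integrable fun x : EuclideanSpace ℝ (Fin 2) => Real.exp ((1 - lam) / 4 * ‖x‖ ^ 2) * x i ^ 2 * w x ^ 2 :=
      integrable_mul_of_hasCompactSupport (hpc.mul ((hpi i).pow 2)) (hw.continuous.pow 2) hws
    exact this.congr (Eventually.of_forall fun x => by beta_reduce; ring)
  have hGi : ∀ i : Fin 2, (1 - lam) ^ 2 / 16 * ∫ x, Real.exp ((1 - lam) / 4 * ‖x‖ ^ 2) * (x i ^ 2 * w x ^ 2) ≤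
      (∫ x, Real.exp ((1 - lam) / 4 * ‖x‖ ^ 2) * fderiv ℝ w x (EuclideanSpace.single i 1) ^ 2) - (1 - lam) / 4 * ∫ x, Real.exp ((1 - lam) / 4 * ‖x‖ ^ 2) * w x ^ 2 := by
    intro i
    have h0 : 0 ≤ ∫ x, Real.exp ((1 - lam) / 4 * ‖x‖ ^ 2) * (fderiv ℝ w x (EuclideanSpace.single i 1) + (1 - lam) / 4 * x i * w x) ^ 2 :=
      integral_nonneg fun x => by positivity
    have k2 : Integrable fun x : EuclideanSpace ℝ (Fin 2) => 2 * ((1 - lam) / 4) *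
        (Real.exp ((1 - lam) / 4 * ‖x‖ ^ 2) * w x * (x i * fderiv ℝ w x (EuclideanSpace.single i 1))) := (jI i).const_mul _
    have k3 : Integrable fun x : EuclideanSpace ℝ (Fin 2) => ((1 - lam) / 4) ^ 2 * (Real.exp ((1 - lam) / 4 * ‖x‖ ^ 2) * (x i ^ 2 * w x ^ 2)) :=
      (jM i).const_mul _
    have hF2 : Integrable fun x : EuclideanSpace ℝ (Fin 2) => Real.exp ((1 - lam) / 4 * ‖x‖ ^ 2) * fderiv ℝ w x (EuclideanSpace.single i 1) ^ 2 +
        2 * ((1 - lam) / 4) * (Real.exp ((1 - lam) / 4 * ‖x‖ ^ 2) * w x * (x i * fderiv ℝ w x (EuclideanSpace.single i 1))) :=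
      (iX i).add k2
    have hexp : ∫ x, Real.exp ((1 - lam) / 4 * ‖x‖ ^ 2) * (fderiv ℝ w x (EuclideanSpace.single i 1) + (1 - lam) / 4 * x i * w x) ^ 2 =
        (∫ x, Real.exp ((1 - lam) / 4 * ‖x‖ ^ 2) * fderiv ℝ w x (EuclideanSpace.single i 1) ^ 2) +
        2 * ((1 - lam) / 4) * (∫ x, Real.exp ((1 - lam) / 4 * ‖x‖ ^ 2) * w x * (x i * fderiv ℝ w x (EuclideanSpace.single i 1))) +
        ((1 - lam) / 4) ^ 2 * ∫ x, Real.exp ((1 - lam) / 4 * ‖x‖ ^ 2) * (x i ^ 2 * w x ^ 2) := by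
      rw [← integral_const_mul, ← integral_const_mul, ← integral_add (iX i) k2, ← integral_add hF2 k3]
      exact integral_congr_ae (Eventually.of_forall fun x => by beta_reduce; ring)
    have kM : Integrable fun x : EuclideanSpace ℝ (Fin 2) => (1 - lam) / 2 * (Real.exp ((1 - lam) / 4 * ‖x‖ ^ 2) * (x i ^ 2 * w x ^ 2)) := (jM i).const_mul _
    have hI : ∫ x, Real.exp ((1 - lam) / 4 * ‖x‖ ^ 2) * w x * (x i * fderiv ℝ w x (EuclideanSpace.single i 1)) =
        -(1 / 2) * ((∫ x, Real.exp ((1 - lam) / 4 * ‖x‖ ^ 2) * w x ^ 2) + (1 - lam) / 2 * ∫ x, Real.exp ((1 - lam) / 4 * ‖x‖ ^ 2) * (x i ^ 2 * w x ^ 2)) := by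
      have h := integral_mul_mul_coord_mul_fderiv_eq hwc (contDiff_gaussWeightExp (1 - lam) (n := 1)) hw1 i
      rw [h, ← integral_const_mul ((1 - lam) / 2), ← integral_add iNw kM]
      congr 1
      refine integral_congr_ae (Eventually.of_forall fun x => ?_)
      simp only [fderiv_gaussWeightExp_single]
      ring
    rw [hexp, hI] at h0
    nlinarith [h0]
  have hnormsq : ∀ x : EuclideanSpace ℝ (Fin 2), ‖x‖ ^ 2 = x 0 ^ 2 + x 1 ^ 2 := fun x => by
    rw [EuclideanSpace.norm_sq_eq]; simp [Fin.sum_univ_two]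
  have hMsum : ∫ x, Real.exp ((1 - lam) / 4 * ‖x‖ ^ 2) * (‖x‖ ^ 2 * w x ^ 2) = (∫ x, Real.exp ((1 - lam) / 4 * ‖x‖ ^ 2) * (x 0 ^ 2 * w x ^ 2)) + ∫ x, Real.exp ((1 - lam) / 4 * ‖x‖ ^ 2) * (x 1 ^ 2 * w x ^ 2) := by
    rw [← integral_add (jM 0) (jM 1)]
    refine integral_congr_ae (Eventually.of_forall fun x => ?_)
    simp only [hnormsq x]
    ring
  rw [hMsum, hX2eq]
  have h0 := hGi 0
  have h1 := hGi 1
  linarith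

/-- **The test pair** `|∫ p u f| ≤ √((2 + 2C₁) ∫ p w²) √(∫ p f²)` for `u = w + Φψ`,
`f = L_λw − αΛw` (`p f²` is integrable). [folklore] -/
theorem abs_integral_gaussWeight_corrected_mul_rhs_le (α : ℝ) {C₁ : ℝ}
    (h1 : Integrable (fun x => Real.exp ((1 - lam) / 4 * ‖x‖ ^ 2) * kerWeight ‖x‖ ^ 2 * (∫ y, w y * ((2 * π)⁻¹ * Real.log ‖x - y‖)) ^ 2) ∧
      ∫ x, Real.exp ((1 - lam) / 4 * ‖x‖ ^ 2) * kerWeight ‖x‖ ^ 2 * (∫ y, w y * ((2 * π)⁻¹ * Real.log ‖x - y‖)) ^ 2 ≤ C₁ * ∫ x, Real.exp ((1 - lam) / 4 * ‖x‖ ^ 2) * w x ^ 2) :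
    Integrable (fun x => Real.exp ((1 - lam) / 4 * ‖x‖ ^ 2) * (strainedVorticityOperator lam w x - α * (⟪gaussVortexVelocity x, gradient w x⟫ + ⟪biotSavart2D w x, gradient gaussVortexProfile x⟫)) ^ 2) ∧
    |∫ x, Real.exp ((1 - lam) / 4 * ‖x‖ ^ 2) * (w x + kerWeight ‖x‖ * ∫ y, w y * ((2 * π)⁻¹ * Real.log ‖x - y‖)) * (strainedVorticityOperator lam w x - α * (⟪gaussVortexVelocity x, gradient w x⟫ + ⟪biotSavart2D w x, gradient gaussVortexProfile x⟫))| ≤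
      Real.sqrt ((2 + 2 * C₁) * ∫ x, Real.exp ((1 - lam) / 4 * ‖x‖ ^ 2) * w x ^ 2) * Real.sqrt (∫ x, Real.exp ((1 - lam) / 4 * ‖x‖ ^ 2) * (strainedVorticityOperator lam w x - α * (⟪gaussVortexVelocity x, gradient w x⟫ + ⟪biotSavart2D w x, gradient gaussVortexProfile x⟫)) ^ 2) := by
  have ha0 : 0 < 1 - lam := by linarith
  have hw1 : ContDiff ℝ 1 w := hw.of_le one_le_two
  have hpc : Continuous fun x : EuclideanSpace ℝ (Fin 2) => Real.exp ((1 - lam) / 4 * ‖x‖ ^ 2) := (contDiff_gaussWeightExp (1 - lam) (n := 0)).continuous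
  have hΦc : Continuous fun x : EuclideanSpace ℝ (Fin 2) => kerWeight ‖x‖ := continuous_kerWeight.comp continuous_norm
  have hψc : Continuous fun x : EuclideanSpace ℝ (Fin 2) => (∫ y, w y * ((2 * π)⁻¹ * Real.log ‖x - y‖)) := (contDiff_logPotential (n := 1) hw1 hwc).continuous
  have huc : Continuous fun x : EuclideanSpace ℝ (Fin 2) => (w x + kerWeight ‖x‖ * ∫ y, w y * ((2 * π)⁻¹ * Real.log ‖x - y‖)) := (contDiff_one_corrected hw hwc).continuous
  have hAc : Continuous fun x : EuclideanSpace ℝ (Fin 2) => strainedVorticityOperator lam w x := continuous_strainedVorticityOperator_of_contDiff_two hw lam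
  have hAs : HasCompactSupport fun x : EuclideanSpace ℝ (Fin 2) => strainedVorticityOperator lam w x := hasCompactSupport_strainedVorticityOperator hw hwc lam
  have hΛc : Continuous fun x : EuclideanSpace ℝ (Fin 2) => (⟪gaussVortexVelocity x, gradient w x⟫ + ⟪biotSavart2D w x, gradient gaussVortexProfile x⟫) := continuous_gaussLambda hw hwc
  have iNw : Integrable fun x : EuclideanSpace ℝ (Fin 2) => Real.exp ((1 - lam) / 4 * ‖x‖ ^ 2) * w x ^ 2 :=
    (integral_exp_eighth_mul_sq_le ha0.le hw.continuous hwc).1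
  obtain ⟨-, iΛ⟩ := integrable_gaussWeight_mul_gaussLambda hw hwc (by linarith : (1 - lam) < 2)
  have iPA2 : Integrable fun x : EuclideanSpace ℝ (Fin 2) => Real.exp ((1 - lam) / 4 * ‖x‖ ^ 2) * strainedVorticityOperator lam w x * strainedVorticityOperator lam w x :=
    integrable_mul_of_hasCompactSupport (hpc.mul hAc) hAc hAs
  have iPAΛ : Integrable fun x : EuclideanSpace ℝ (Fin 2) => Real.exp ((1 - lam) / 4 * ‖x‖ ^ 2) * (⟪gaussVortexVelocity x, gradient w x⟫ + ⟪biotSavart2D w x, gradient gaussVortexProfile x⟫) * strainedVorticityOperator lam w x :=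
    integrable_mul_of_hasCompactSupport (hpc.mul hΛc) hAc hAs
  have iNf : Integrable fun x : EuclideanSpace ℝ (Fin 2) => Real.exp ((1 - lam) / 4 * ‖x‖ ^ 2) * (strainedVorticityOperator lam w x - α * (⟪gaussVortexVelocity x, gradient w x⟫ + ⟪biotSavart2D w x, gradient gaussVortexProfile x⟫)) ^ 2 := by
    have e : (fun x : EuclideanSpace ℝ (Fin 2) => Real.exp ((1 - lam) / 4 * ‖x‖ ^ 2) * (strainedVorticityOperator lam w x - α * (⟪gaussVortexVelocity x, gradient w x⟫ + ⟪biotSavart2D w x, gradient gaussVortexProfile x⟫)) ^ 2) = fun x =>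
        Real.exp ((1 - lam) / 4 * ‖x‖ ^ 2) * strainedVorticityOperator lam w x * strainedVorticityOperator lam w x - 2 * α * (Real.exp ((1 - lam) / 4 * ‖x‖ ^ 2) * (⟪gaussVortexVelocity x, gradient w x⟫ + ⟪biotSavart2D w x, gradient gaussVortexProfile x⟫) * strainedVorticityOperator lam w x) + α ^ 2 * (Real.exp ((1 - lam) / 4 * ‖x‖ ^ 2) * (⟪gaussVortexVelocity x, gradient w x⟫ + ⟪biotSavart2D w x, gradient gaussVortexProfile x⟫) ^ 2) := by
      funext x; ring
    rw [e]
    exact (iPA2.sub (iPAΛ.const_mul _)).add (iΛ.const_mul _)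
  refine ⟨iNf, ?_⟩
  have hmaj : Integrable fun x : EuclideanSpace ℝ (Fin 2) => 2 * (Real.exp ((1 - lam) / 4 * ‖x‖ ^ 2) * w x ^ 2) + 2 * (Real.exp ((1 - lam) / 4 * ‖x‖ ^ 2) * kerWeight ‖x‖ ^ 2 * (∫ y, w y * ((2 * π)⁻¹ * Real.log ‖x - y‖)) ^ 2) :=
    (iNw.const_mul 2).add (h1.1.const_mul 2)
  have hpt : ∀ x : EuclideanSpace ℝ (Fin 2), Real.exp ((1 - lam) / 4 * ‖x‖ ^ 2) * (w x + kerWeight ‖x‖ * ∫ y, w y * ((2 * π)⁻¹ * Real.log ‖x - y‖)) ^ 2 ≤ 2 * (Real.exp ((1 - lam) / 4 * ‖x‖ ^ 2) * w x ^ 2) + 2 * (Real.exp ((1 - lam) / 4 * ‖x‖ ^ 2) * kerWeight ‖x‖ ^ 2 * (∫ y, w y * ((2 * π)⁻¹ * Real.log ‖x - y‖)) ^ 2) := by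
    intro x
    have he := (Real.exp_pos ((1 - lam) / 4 * ‖x‖ ^ 2)).le
    nlinarith [mul_nonneg he (sq_nonneg (w x - kerWeight ‖x‖ * (∫ y, w y * ((2 * π)⁻¹ * Real.log ‖x - y‖))))]
  have iPu2 : Integrable fun x : EuclideanSpace ℝ (Fin 2) => Real.exp ((1 - lam) / 4 * ‖x‖ ^ 2) * (w x + kerWeight ‖x‖ * ∫ y, w y * ((2 * π)⁻¹ * Real.log ‖x - y‖)) ^ 2 :=
    hmaj.mono' (hpc.mul (huc.pow 2)).aestronglyMeasurable (Eventually.of_forall fun x => by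
      rw [Real.norm_of_nonneg (by positivity)]; exact hpt x)
  have hPu2 : ∫ x, Real.exp ((1 - lam) / 4 * ‖x‖ ^ 2) * (w x + kerWeight ‖x‖ * ∫ y, w y * ((2 * π)⁻¹ * Real.log ‖x - y‖)) ^ 2 ≤ (2 + 2 * C₁) * ∫ x, Real.exp ((1 - lam) / 4 * ‖x‖ ^ 2) * w x ^ 2 := by
    calc ∫ x, Real.exp ((1 - lam) / 4 * ‖x‖ ^ 2) * (w x + kerWeight ‖x‖ * ∫ y, w y * ((2 * π)⁻¹ * Real.log ‖x - y‖)) ^ 2 ≤ ∫ x, 2 * (Real.exp ((1 - lam) / 4 * ‖x‖ ^ 2) * w x ^ 2) + 2 * (Real.exp ((1 - lam) / 4 * ‖x‖ ^ 2) * kerWeight ‖x‖ ^ 2 * (∫ y, w y * ((2 * π)⁻¹ * Real.log ‖x - y‖)) ^ 2) :=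
          integral_mono iPu2 hmaj hpt
      _ = 2 * (∫ x, Real.exp ((1 - lam) / 4 * ‖x‖ ^ 2) * w x ^ 2) + 2 * ∫ x, Real.exp ((1 - lam) / 4 * ‖x‖ ^ 2) * kerWeight ‖x‖ ^ 2 * (∫ y, w y * ((2 * π)⁻¹ * Real.log ‖x - y‖)) ^ 2 := by
          rw [integral_add (iNw.const_mul 2) (h1.1.const_mul 2), integral_const_mul, integral_const_mul]
      _ ≤ _ := by
          have h := mul_le_mul_of_nonneg_left h1.2 (by norm_num : (0:ℝ) ≤ 2); linarith
  have h := abs_integral_gaussWeight_mul_mul_le_sqrt (fun x => (Real.exp_pos _).le) hpc.measurable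
    huc.measurable (hAc.sub (continuous_const.mul hΛc)).measurable iPu2 iNf
  exact h.trans (mul_le_mul_of_nonneg_right (Real.sqrt_le_sqrt hPu2) (Real.sqrt_nonneg _))

end Energy

/-- The scalar bookkeeping of the energy estimate (Cauchy–Schwarz absorptions). [folklore] -/
theorem asymBurgers_energy_bookkeeping {Nw Nf X2 Mr T UF Vw PwA C₁ M a : ℝ} (hN0 : 0 ≤ Nw) (hNf0 : 0 ≤ Nf)
    (hX20 : 0 ≤ X2) (hC₁0 : 0 ≤ C₁) (hM0 : 0 ≤ M) (ha0 : 0 < a)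
    (e1 : PwA = -X2 + Vw) (hVle : Vw ≤ Nw) (e2 : PwA = UF - T)
    (hTb : |T| ≤ 2 * (Real.sqrt (M * Nw) + Real.sqrt (C₁ * Nw)) * Real.sqrt X2 +
      Real.sqrt (C₁ * Nw) * Real.sqrt Nw)
    (hUF : |UF| ≤ Real.sqrt ((2 + 2 * C₁) * Nw) * Real.sqrt Nf)
    (hG : a ^ 2 / 16 * Mr ≤ X2 - a / 2 * Nw) :
    X2 + Mr ≤ (1 + 16 / a ^ 2) *
      (2 * (2 + C₁ + Real.sqrt C₁) + (2 * (Real.sqrt M + Real.sqrt C₁)) ^ 2 + 1) * (Nw + Nf) := by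
  set S : ℝ := 2 * (Real.sqrt M + Real.sqrt C₁) with hS
  have hS0 : 0 ≤ S := by positivity
  set K : ℝ := 2 * (2 + C₁ + Real.sqrt C₁) + S ^ 2 + 1 with hK
  set sN := Real.sqrt Nw with hsN
  set sF := Real.sqrt Nf with hsF
  set sX := Real.sqrt X2 with hsX
  have hsN2 : sN ^ 2 = Nw := Real.sq_sqrt hN0
  have hsF2 : sF ^ 2 = Nf := Real.sq_sqrt hNf0
  have hsX2 : sX ^ 2 = X2 := Real.sq_sqrt hX20
  have hsN0 : 0 ≤ sN := Real.sqrt_nonneg _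
  have hsF0 : 0 ≤ sF := Real.sqrt_nonneg _
  have hsX0 : 0 ≤ sX := Real.sqrt_nonneg _
  have hsM : Real.sqrt (M * Nw) = Real.sqrt M * sN := Real.sqrt_mul hM0 _
  have hsC : Real.sqrt (C₁ * Nw) = Real.sqrt C₁ * sN := Real.sqrt_mul hC₁0 _
  have hs2 : Real.sqrt ((2 + 2 * C₁) * Nw) = Real.sqrt (2 + 2 * C₁) * sN :=
    Real.sqrt_mul (by positivity) _
  have hq2 : Real.sqrt (2 + 2 * C₁) ^ 2 = 2 + 2 * C₁ := Real.sq_sqrt (by positivity)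
  have hrM : 0 ≤ Real.sqrt M := Real.sqrt_nonneg _
  have hrC : 0 ≤ Real.sqrt C₁ := Real.sqrt_nonneg _
  have hr2 : 0 ≤ Real.sqrt (2 + 2 * C₁) := Real.sqrt_nonneg _
  rw [hsM, hsC] at hTb
  rw [hs2] at hUF
  have hX2le : X2 ≤ Nw + |UF| + |T| := by
    have e3 : -UF ≤ |UF| := neg_le_abs _
    have e4 : T ≤ |T| := le_abs_self _
    linarith
  have hTb' : |T| ≤ S * sN * sX + Real.sqrt C₁ * Nw := by
    calc |T| ≤ _ := hTb
      _ = S * sN * sX + Real.sqrt C₁ * Nw := by rw [hS, ← hsN2]; ring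
  have am1 : 2 * (S * sN * sX) ≤ X2 + S ^ 2 * Nw := by
    have h := sq_nonneg (sX - S * sN)
    have e : (sX - S * sN) ^ 2 = sX ^ 2 - 2 * (S * sN * sX) + S ^ 2 * sN ^ 2 := by ring
    rw [e, hsX2, hsN2] at h
    linarith
  have am2 : 2 * (Real.sqrt (2 + 2 * C₁) * sN * sF) ≤ (2 + 2 * C₁) * Nw + Nf := by
    have h := sq_nonneg (Real.sqrt (2 + 2 * C₁) * sN - sF)
    have e : (Real.sqrt (2 + 2 * C₁) * sN - sF) ^ 2 = Real.sqrt (2 + 2 * C₁) ^ 2 * sN ^ 2 -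
        2 * (Real.sqrt (2 + 2 * C₁) * sN * sF) + sF ^ 2 := by ring
    rw [e, hq2, hsN2, hsF2] at h
    linarith
  have hX2K : X2 ≤ K * (Nw + Nf) := by
    have h5 : X2 ≤ (2 * (2 + C₁ + Real.sqrt C₁) + S ^ 2) * Nw + Nf := by
      linarith [hX2le, hTb', hUF, am1, am2]
    rw [hK]
    have p1 := mul_nonneg hC₁0 hNf0
    have p2 := mul_nonneg hrC hNf0
    have p3 := mul_nonneg (sq_nonneg S) hNf0
    linarith
  have hK0 : 0 ≤ K := by positivity
  have hMrle : Mr ≤ 16 / a ^ 2 * X2 := by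
    have hG' : a ^ 2 / 16 * Mr ≤ X2 := by
      have : 0 ≤ a / 2 * Nw := by positivity
      linarith
    calc Mr = 16 / a ^ 2 * (a ^ 2 / 16 * Mr) := by field_simp
      _ ≤ 16 / a ^ 2 * X2 := mul_le_mul_of_nonneg_left hG' (by positivity)
  calc X2 + Mr ≤ X2 + 16 / a ^ 2 * X2 := by linarith
    _ = (1 + 16 / a ^ 2) * X2 := by ring
    _ ≤ (1 + 16 / a ^ 2) * (K * (Nw + Nf)) := mul_le_mul_of_nonneg_left hX2K (by positivity)
    _ = (1 + 16 / a ^ 2) * K * (Nw + Nf) := by ring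

/-- **Maekawa 2009, Lemma 4.1 (4.1), energy part, a-priori form with an `α`-uniform constant.**
For `λ ∈ [0,1)` there is `C = C(λ)` such that for every circulation `α ∈ ℝ` and every
`w ∈ C²_c(ℝ²)`, with `p = e^{(1−λ)|x|²/4} ∝ G_λ⁻¹` and `f = (L + λM)w − αΛw`: `p f²` is integrable
and `∫ p |∇w|² + ∫ p |x|² w² ≤ C (∫ p w² + ∫ p f²)` (the `Y_λ ∩ W_λ`-control of (4.1), constant
independent of `α`). [cite: Maekawa2009b, §4 Lemma 4.1 (4.1), Prop. 4.1] -/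
theorem asymBurgers_uniform_energy_bound {lam : ℝ} (hlam0 : 0 ≤ lam) (hlam1 : lam < 1) :
    ∃ C, 0 ≤ C ∧ ∀ (α : ℝ) (w : EuclideanSpace ℝ (Fin 2) → ℝ), ContDiff ℝ 2 w → HasCompactSupport w →
      Integrable (fun x => Real.exp ((1 - lam) / 4 * ‖x‖ ^ 2) * (strainedVorticityOperator lam w x - α * (⟪gaussVortexVelocity x, gradient w x⟫ + ⟪biotSavart2D w x, gradient gaussVortexProfile x⟫)) ^ 2) ∧
      (∫ x, Real.exp ((1 - lam) / 4 * ‖x‖ ^ 2) * (fderiv ℝ w x (EuclideanSpace.single 0 1) ^ 2 + fderiv ℝ w x (EuclideanSpace.single 1 1) ^ 2)) + ∫ x, Real.exp ((1 - lam) / 4 * ‖x‖ ^ 2) * (‖x‖ ^ 2 * w x ^ 2) ≤ C * ((∫ x, Real.exp ((1 - lam) / 4 * ‖x‖ ^ 2) * w x ^ 2) + ∫ x, Real.exp ((1 - lam) / 4 * ‖x‖ ^ 2) * (strainedVorticityOperator lam w x - α * (⟪gaussVortexVelocity x, gradient w x⟫ + ⟪biotSavart2D w x, gradient gaussVortexProfile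 x⟫)) ^ 2) := by
  obtain ⟨C₁, hC₁0, hC₁⟩ := exists_gaussWeight_potential_bounds hlam0 hlam1
  have ha0 : 0 < 1 - lam := by linarith
  have ha1 : 1 - lam ≤ 1 := by linarith
  have hM0 : 0 ≤ 3 * (((1 - lam) / 2) ^ 2 + 2) * C₁ := by positivity
  refine ⟨(1 + 16 / (1 - lam) ^ 2) * (2 * (2 + C₁ + Real.sqrt C₁) +
    (2 * (Real.sqrt (3 * (((1 - lam) / 2) ^ 2 + 2) * C₁) + Real.sqrt C₁)) ^ 2 + 1), by positivity,
    fun α w hw hwc => ?_⟩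
  obtain ⟨h1, h2, h3, h4⟩ := hC₁ w hw.continuous hwc
  obtain ⟨iNf, hUF⟩ := abs_integral_gaussWeight_corrected_mul_rhs_le hlam0 hlam1 hw hwc α h1
  refine ⟨iNf, ?_⟩
  have hTb := abs_integral_gaussWeight_correction_mul_strained_le hlam0 hlam1 hw hwc h1 h2 h3 h4
  have hG := gaussWeight_ground_state_bound hlam1 hw hwc
  have hS4 := integral_mul_mul_strainedVorticityOperator_eq hwc (contDiff_gaussWeightExp (1 - lam)) hw lam
  have hT := integral_gaussWeight_mul_mul_strained_eq hw hwc ha0.le ha1 lam α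
  have hpc : Continuous fun x : EuclideanSpace ℝ (Fin 2) => Real.exp ((1 - lam) / 4 * ‖x‖ ^ 2) := (contDiff_gaussWeightExp (1 - lam) (n := 0)).continuous
  have hpi : ∀ j : Fin 2, Continuous fun x : EuclideanSpace ℝ (Fin 2) => x j := fun j =>
    (EuclideanSpace.proj (j : Fin 2) : EuclideanSpace ℝ (Fin 2) →L[ℝ] ℝ).continuous
  have hws : HasCompactSupport fun x : EuclideanSpace ℝ (Fin 2) => w x ^ 2 := hwc.comp_left (g := fun t : ℝ => t ^ 2) (by simp)
  have iNw : Integrable fun x : EuclideanSpace ℝ (Fin 2) => Real.exp ((1 - lam) / 4 * ‖x‖ ^ 2) * w x ^ 2 :=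
    (integral_exp_eighth_mul_sq_le ha0.le hw.continuous hwc).1
  have iV : Integrable fun x : EuclideanSpace ℝ (Fin 2) => Real.exp ((1 - lam) / 4 * ‖x‖ ^ 2) * ((2 - lam) / 2 - (1 - lam) * lam / 4 * x 0 ^ 2) * w x ^ 2 :=
    integrable_mul_of_hasCompactSupport (hpc.mul (continuous_const.sub (continuous_const.mul
      ((hpi 0).pow 2)))) (hw.continuous.pow 2) hws
  have hS4' : ∫ x, Real.exp ((1 - lam) / 4 * ‖x‖ ^ 2) * w x * strainedVorticityOperator lam w x = -(∫ x, Real.exp ((1 - lam) / 4 * ‖x‖ ^ 2) * (fderiv ℝ w x (EuclideanSpace.single 0 1) ^ 2 + fderiv ℝ w x (EuclideanSpace.single 1 1) ^ 2)) + ∫ x, Real.exp ((1 - lam) / 4 * ‖x‖ ^ 2) * ((2 - lam) / 2 - (1 - lam) * lam / 4 * x 0 ^ 2) * w x ^ 2 := by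
    rw [hS4]
    congr 1
    exact integral_congr_ae (Eventually.of_forall fun x => by
      simp only [gaussWeightExp_energyWeight_eq])
  have hVle : ∫ x, Real.exp ((1 - lam) / 4 * ‖x‖ ^ 2) * ((2 - lam) / 2 - (1 - lam) * lam / 4 * x 0 ^ 2) * w x ^ 2 ≤ ∫ x, Real.exp ((1 - lam) / 4 * ‖x‖ ^ 2) * w x ^ 2 :=
    integral_mono iV iNw fun x => mul_le_mul_of_nonneg_right
      (gaussWeightExp_energyWeight_le hlam0 hlam1.le x) (sq_nonneg _)
  have hN0 : 0 ≤ ∫ x, Real.exp ((1 - lam) / 4 * ‖x‖ ^ 2) * w x ^ 2 := integral_nonneg fun x => by positivity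
  have hNf0 : 0 ≤ ∫ x, Real.exp ((1 - lam) / 4 * ‖x‖ ^ 2) * (strainedVorticityOperator lam w x - α * (⟪gaussVortexVelocity x, gradient w x⟫ + ⟪biotSavart2D w x, gradient gaussVortexProfile x⟫)) ^ 2 := integral_nonneg fun x => by positivity
  have hX20 : 0 ≤ ∫ x, Real.exp ((1 - lam) / 4 * ‖x‖ ^ 2) * (fderiv ℝ w x (EuclideanSpace.single 0 1) ^ 2 + fderiv ℝ w x (EuclideanSpace.single 1 1) ^ 2) := integral_nonneg fun x => by positivity
  exact asymBurgers_energy_bookkeeping hN0 hNf0 hX20 hC₁0 hM0 ha0 hS4' hVle hT hTb hUF hG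

end Literature.Analysis.FluidPDE
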